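import Literature.AlgebraicGeometry.Motives.HodgeThetaAnnihilatorTimesRigidSymplectic
import Literature.AlgebraicGeometry.Motives.HodgeThetaSubalgebraGluedRealBlocks
import Literature.AlgebraicGeometry.Motives.HodgeThetaAnnihilatorSemisimpleTimesAbelian
import HarnessLib

/-!
# Rational tensors on `V₁ ⊕ V₂` killed by `Θ` are killed by `ι₁ Θ₁ π₁` when the admissible algebras of `V₂` are GLUED `𝔰𝔩₂`-BLOCKS and `Hom_Hdg(V₂, V₁) = 0` (Moonen–Zarhin 1999 Lemma (3.4), Lie form, for a second factor of Hazama–Murty type: `Hg(X₁ × X₂) = Hg(X₁) × Hg(X₂)` for `X₂` an abelian surface with real or quaternionic multiplication and ANY `X₁` with `Hom(X₂, X₁) = 0`)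

Family `hodge`, layer `Literature/AlgebraicGeometry/Motives` (abstract polarizable `ℚ`-Hodge structures; no
geometry). Research context: cell `pub-hodge-ring2` (HONEST FRAMING: research route conditional on HC_CM; not a
corollary; Q11.4-sentence-2 already refuted in dim ≥ 3), Literature lane, programme R25 («`X × S` for `S` a simple
abelian surface of type I(2) (real multiplication by a real quadratic field) or II(1) (an indefinite quaternion
algebra), and ANY `X` with `Hom(S, X) = 0`» — the last non-simple fourfold rows `S × S'` of Moonen–Zarhin's
Thm. 0.1 (4) outside case (a) that the tree lacked: both factors non-generic and not of CM type). UNCONDITIONAL;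
theorems only (no definition, no named fact, D-0026); no step towards a summit statement. This file is the
COMPANION of `HodgeThetaAnnihilatorTimesRigidSymplectic` (programme R23: the second factor RIGID SYMPLECTIC,
`hg(X₂) = 𝔰𝔭_{2g}`), with the symplectic Lie algebra replaced by a GLUED algebra `⊕_{classes} 𝔰𝔩₂(ℂ)` acting
diagonally on two-dimensional blocks — the shape of `hg(X₂) ⊗ ℂ` for every complex abelian variety with a totally
real self-commutant subfield `K ⊆ End⁰(X₂)` of degree `dim X₂` (Hazama 1983 §3, V. K. Murty 1988 Thm. 2 with
`m = 1`; Moonen–Zarhin (2.2) Types I(2) «`Hg(X) = R_{F/ℚ} SL_{2,F}`» and II(1) «`Hg(X) = U_{D^opp}`»), proved in the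
tree for EVERY admissible algebra by `GluedBlocks.exists_glued_adapted_blockBasis`
(`HodgeThetaSubalgebraGluedRealBlocks`) and its geometric bridges
`TotallyRealMaxSubfieldHodgeLieAlgebra.exists_glued_adapted_blockBasis_of_isMurtyTypeWith_one`,
`TypeIIMinimalPowersHodgeClasses.exists_glued_adapted_blockBasis_of_realSplitting`.

PRINTED RESULT. B. Moonen, Yu. G. Zarhin, *Hodge classes on abelian varieties of low dimension*, Math. Ann.
**315** (1999) 711–733, Lemma (3.4) [held `paper:arxiv-math_9901113`, chunk p0006 L133–L140, p0007 L1–L8]: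
«Let `X₁` and `X₂` be nonzero complex abelian varieties. Write `X = X₁ × X₂`. Assume that `hg(X₂)` is a
`ℚ`-simple Lie algebra of non-compact type and that, up to isomorphism, `V_{X₂}` is the only irreducible
`hg(X₂)`-module which is a length 1 representation of non-compact type. Then either `Hg(X) = Hg(X₁) × Hg(X₂)` or
`Hom(X₂, X₁) ≠ 0`», with (2.4)(3) [chunk p0005 L113–L124] «Suppose `X` [simple of dimension `≤ 3`] is not of
CM-type. Then `Hg(X)` is a `ℚ`-simple algebraic group, except when `dim(X) = 3` and `End⁰(X)` is an imaginary
quadratic field. If `Hg(X)` is `ℚ`-simple then (up to isomorphism) there is exactly one faithful irreducible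
representation of `hg(X)` over `ℚ` which is of length 1», used in §5 (5.4) [chunk p0009 L104–L108]: «If
`dim(X₂) < 3` then the desired equality `Hg(X) = Hg(X₁) × Hg(X₂)` follows from (2.4) and (3.4)», and (5.5)
[L110–L118] «This only leaves us with the case where `X ∼ X₁ × X₂`, with `X₁` and `X₂` simple abelian surfaces
… [the] Proposition [of §4] shows that `Hg(X) = Hg(X₁) × Hg(X₂)`». With (3.1): `Hg(X₁ × X₂) = Hg(X₁) × Hg(X₂)` iff the
Hodge ring of every `X₁^m × X₂^n` is generated by the classes coming from the factors.

SETTING (as in the companion). A `ℚ`-space `U` presented as `V₁ ⊕ V₂` (`ι₁, π₁, ι₂, π₂`); effective weight-one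
Hodge structures `H_U`, `H₁`, `H₂` with `ι₁`, `ι₂` mapping Hodge pieces into Hodge pieces; polarizations `ψ₁`,
`ψ₂`; Hodge operators `Θ₁`, `Θ₂`, `Θ_U`. On `V₂ ⊗ ℂ`: an internal decomposition `⊕_{k ∈ κ} T_k` into
two-dimensional blocks with bases `b₂ k = (b₂ k 0 ∈ V₂^{1,0}, b₂ k 1 ∈ V₂^{0,1})` and an idempotent class map
`cls : κ → κ`, with three hypotheses: (GLUED) every ADMISSIBLE rational `𝔤₂ ⊆ End_ℚ(V₂)` (bracket-closed,
`ψ₂`-skew, commuting with `End_Hdg(V₂)`, `Θ₂ ∈ (𝔤₂)_ℂ`) has trace-free blocks, equal blocks along each class, and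
contains every class operator `𝟙_c · N` (`tr N = 0`) in its complex span — VERBATIM the output of the tree's glued
block theorem; (BLOCKS) rational operators commuting with `End_Hdg(V₂)` preserve the blocks; (QS) a non-zero
rational `ψ₂`-skew operator commuting with `End_Hdg(V₂)` is non-zero on every block (`H¹(X₂)` is free over the
totally real field `K` whose eigenspaces are the blocks: «`hg(X₂)` is `ℚ`-simple»); and (HOM) no non-zero
`ℚ`-linear `V₂ → V₁` maps Hodge pieces into Hodge pieces («`Hom(X₂, X₁) = 0`», Riemann).

MAIN RESULTS. §2 THE WITNESS `GluedWitness.exists_equivariant_ne_zero` — in a `Θ`-graded representation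
`ρ : 𝔰 → End W` of the glued algebra `𝔰 = ⊕_{classes} 𝔰𝔩₂` (bracket-preserving, `ρ[h, ·] = [Θ, ρ·]`, `Θ² = 1`,
injective) the standard representation of one block occurs: a non-zero `ρ`-equivariant `F : M → W` (Moonen–Zarhin's
«`V_{X₂}` is the only … length 1 representation», in elementary form: `E = ρ(e_c)`, `F' = ρ(f_c)` are
`Θ`-raising and `Θ`-lowering, `E F' E = E`, and `b 0 ↦ Eu`, `b 1 ↦ F'Eu` for `Θu = -u`, `Eu ≠ 0`; the other classes act by
raising, lowering and Cartan parts `[A, B]`, all killing `Eu`, `F'Eu` by `Θ`-weights), and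
`GluedWitness.theta_comp_eq_of_equivariant` (equivariant maps intertwine the gradings). §3 `𝔰𝔩₂` IS SIMPLE
(`GluedIdeal.sl2_triple_mem`, Humphreys §2.1) and `GluedIdeal.assemble_sH_mem`: an ideal of the glued algebra
containing an element all of whose blocks are non-zero contains the Hodge operator. §4 THE GOURSAT STEP
`goursat_incl_corner_mem_of_hom_eq_zero_of_glued`: for a bracket-closed rational `𝔞 ⊆ End_ℚ(U)` of block-diagonal
operators with skew corners commuting with `End_Hdg(V₂)` and `Θ_U ∈ 𝔞_ℂ`, under (GLUED), (BLOCKS), (QS), (HOM):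
`ι₁ c₁X π₁ ∈ 𝔞` for all `X ∈ 𝔞` — if `K = 𝔞 ∩ ker c₁ ≠ 0` by §3 and descent; the graph case `K = 0` is excluded
as in the companion (reductivity `exists_ideal_compl`, `ρ = c₁ ∘ c₂⁻¹` on `(𝔞₃)_ℂ ≅ 𝔰`, the witness of §2,
descent of commutants `mem_span_baseChange_of_forall_commute`, (HOM)). §5 THE THEOREMS for the annihilator
algebra `annLie` of a rational Hodge tensor `q` on `U` (commuting family: `End_Hdg(V₁)`, `End_Hdg(V₂)` and the
projectors): `incl_corner_mem_annLie_of_times_gluedBlocks`, `incl₁_theta_proj_mem_spanC_annLie_of_times_gluedBlocks`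
and **`wordDerAt_incl_proj_theta_eq_zero_of_times_gluedBlocks`**: a rational coefficient tensor killed slice by
slice by the matrix of `Θ_U` is killed by the matrix of `ι₁ ∘ Θ₁ ∘ π₁` — the conclusion consumed verbatim by the
typed-Künneth pipeline of programmes R22/R23 (`HodgeTheory/TimesGluedBlocksInvariance`).

## References

* [MoonenZarhin1999LowDim] B. Moonen, Yu. G. Zarhin, Math. Ann. 315 (1999) 711–733, §2 (2.2), (2.4), §3 (3.1),
  Lemma (3.3), Lemma (3.4), Remark (3.5), §5 (5.4)–(5.5) (held `paper:arxiv-math_9901113`, chunks p0005–p0007,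
  p0009). [cite: MoonenZarhin1999LowDim, §3 Lemma (3.3) and Lemma (3.4)]
* [Hazama1983] F. Hazama, *Algebraic cycles on abelian varieties with many real endomorphisms*, Tôhoku Math. J.
  35 (1983) 303–308, Lemma (3.1) and §3 pp. 305–306 («`𝔥 = 𝔰𝔩₂ × ⋯ × 𝔰𝔩₂` where the i-th component acts on
  `V_i ⊕ ⋯ ⊕ V_i` diagonally»). [cite: Hazama1983, §3 (pp. 305–306)]
* [Murty1988] V. Kumar Murty, *The Hodge group of an abelian variety*, Proc. AMS 104 (1988), Thm. 2 (p. 67).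
  [cite: Murty1988, Thm. 2 (p. 67)]
* [Hazama1989] F. Hazama, Duke Math. J. 58 (1989) 31–37 (Goursat for Hodge Lie algebras).
  [cite: Hazama1989, Thm. (= Gordon 7.6.2)]
* [Deligne1982HodgeCycles] P. Deligne, *Hodge cycles on abelian varieties*, LNM 900 (1982), I §3 (proof of Prop.
  3.4: rational structures, base change), Prop. 3.6 (`Hg` reductive). [cite: Deligne1982HodgeCycles, I §3 Prop. 3.4 and Prop. 3.6]
* [Humphreys1972] J. E. Humphreys, GTM 9 (1972), §2.1 Example (`𝔰𝔩₂` is simple), §7.2. [cite: Humphreys1972, §2.1 Example]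
* [GoodmanWallachGTM255] R. Goodman, N. R. Wallach, GTM 255 (2009), §2.5.3 (`𝔰𝔩₂` triples), §4.1.1.
  [cite: GoodmanWallachGTM255, §2.5.3 and §4.1.1]
-/

noncomputable section

open scoped TensorProduct
open CategoryTheory Module

namespace Literature.AlgebraicGeometry.Motives

namespace HodgeStructure

open RealPlaces Literature.RepresentationTheory.GeneralLinear

/-! ### §0 The standard triple of `2 × 2` matrices and class-supported block families -/

section Matrices


/-- `h e - e h = 2e` for `e = E₀₁`, `h = diag(1,-1)`. [cite: GoodmanWallachGTM255, §2.5.3 and §4.1.1] -/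
theorem GluedWitness.sH_mul_sE_sub :
    (Matrix.diagonal ![(1 : ℂ), -1]) * (Matrix.single (0 : Fin 2) (1 : Fin 2) (1 : ℂ)) - (Matrix.single (0 : Fin 2) (1 : Fin 2) (1 : ℂ)) * (Matrix.diagonal ![(1 : ℂ), -1]) =
      (2 : ℂ) • (Matrix.single (0 : Fin 2) (1 : Fin 2) (1 : ℂ)) := by
  ext a c
  fin_cases a <;> fin_cases c <;> simp [Matrix.mul_apply, Matrix.single, Matrix.diagonal, one_add_one_eq_two]

/-- `h f - f h = -2f` for `f = E₁₀`, `h = diag(1,-1)`. [cite: GoodmanWallachGTM255, §2.5.3 and §4.1.1] -/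
theorem GluedWitness.sH_mul_sF_sub :
    (Matrix.diagonal ![(1 : ℂ), -1]) * (Matrix.single (1 : Fin 2) (0 : Fin 2) (1 : ℂ)) - (Matrix.single (1 : Fin 2) (0 : Fin 2) (1 : ℂ)) * (Matrix.diagonal ![(1 : ℂ), -1]) =
      -((2 : ℂ) • (Matrix.single (1 : Fin 2) (0 : Fin 2) (1 : ℂ))) := by
  rw [← neg_sub]
  congr 1
  ext a c
  fin_cases a <;> fin_cases c <;> simp [Matrix.mul_apply, Matrix.single, Matrix.diagonal, one_add_one_eq_two]

/-- `e f - f e = h`. [cite: GoodmanWallachGTM255, §2.5.3 and §4.1.1] -/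
theorem GluedWitness.sE_mul_sF_sub :
    (Matrix.single (0 : Fin 2) (1 : Fin 2) (1 : ℂ)) * (Matrix.single (1 : Fin 2) (0 : Fin 2) (1 : ℂ)) - (Matrix.single (1 : Fin 2) (0 : Fin 2) (1 : ℂ)) * (Matrix.single (0 : Fin 2) (1 : Fin 2) (1 : ℂ)) =
      (Matrix.diagonal ![(1 : ℂ), -1]) := by
  ext a c
  fin_cases a <;> fin_cases c <;> simp [Matrix.mul_apply, Matrix.single, Matrix.diagonal]

/-- `e e = 0`. [cite: GoodmanWallachGTM255, §4.1.1] -/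
theorem GluedWitness.sE_mul_sE : (Matrix.single (0 : Fin 2) (1 : Fin 2) (1 : ℂ)) * (Matrix.single (0 : Fin 2) (1 : Fin 2) (1 : ℂ)) = 0 := by
  ext a c
  fin_cases a <;> fin_cases c <;> simp [Matrix.mul_apply, Matrix.single]

/-- `f f = 0`. [cite: GoodmanWallachGTM255, §4.1.1] -/
theorem GluedWitness.sF_mul_sF : (Matrix.single (1 : Fin 2) (0 : Fin 2) (1 : ℂ)) * (Matrix.single (1 : Fin 2) (0 : Fin 2) (1 : ℂ)) = 0 := by
  ext a c
  fin_cases a <;> fin_cases c <;> simp [Matrix.mul_apply, Matrix.single]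

/-- A trace-free `2 × 2` matrix is `N₀₁ e + N₁₀ f + N₀₀ h`. [cite: GoodmanWallachGTM255, §2.5.3] -/
theorem GluedWitness.eq_sE_sF_sH_of_trace_eq_zero (N : Matrix (Fin 2) (Fin 2) ℂ) (hN : N.trace = 0) :
    N = N 0 1 • (Matrix.single (0 : Fin 2) (1 : Fin 2) (1 : ℂ)) + N 1 0 • (Matrix.single (1 : Fin 2) (0 : Fin 2) (1 : ℂ)) + N 0 0 • (Matrix.diagonal ![(1 : ℂ), -1]) := by
  rw [Matrix.trace_fin_two] at hN
  have h11 : N 1 1 = -N 0 0 := by linear_combination hN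
  ext a c
  fin_cases a <;> fin_cases c <;> simp [Matrix.single, Matrix.diagonal, h11]

/-- Traces of the standard triple. [cite: GoodmanWallachGTM255, §2.5.3] -/
theorem GluedWitness.trace_sE : ((Matrix.single (0 : Fin 2) (1 : Fin 2) (1 : ℂ))).trace = 0 := by
  rw [Matrix.trace_fin_two]; simp [Matrix.single]

/-- Traces of the standard triple. [cite: GoodmanWallachGTM255, §2.5.3] -/
theorem GluedWitness.trace_sF : ((Matrix.single (1 : Fin 2) (0 : Fin 2) (1 : ℂ))).trace = 0 := by
  rw [Matrix.trace_fin_two]; simp [Matrix.single]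

/-- Traces of the standard triple. [cite: GoodmanWallachGTM255, §2.5.3] -/
theorem GluedWitness.trace_sH : ((Matrix.diagonal ![(1 : ℂ), -1])).trace = 0 := by
  rw [Matrix.trace_fin_two]; simp

/-- `e ≠ 0`. [cite: GoodmanWallachGTM255, §2.5.3] -/
theorem GluedWitness.sE_ne_zero : (Matrix.single (0 : Fin 2) (1 : Fin 2) (1 : ℂ)) ≠ 0 := by
  intro h
  have h01 := congrFun (congrFun h 0) 1
  simp [Matrix.single] at h01

variable {ι : Type*} [DecidableEq ι] (cls : ι → ι)

/-- Products of block families supported on a class: `(𝟙_c · A)(𝟙_c · B) = 𝟙_c · (AB)`. [cite: Hazama1983, §3 (p. 306)] -/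
theorem GluedWitness.clsInd_mul_clsInd (i₀ : ι) (A B : Matrix (Fin 2) (Fin 2) ℂ) :
    ((fun k => if cls k = cls i₀ then A else 0) * fun k => if cls k = cls i₀ then B else 0) =
      fun k => if cls k = cls i₀ then A * B else 0 := by
  funext k
  simp only [Pi.mul_apply]
  split_ifs <;> simp

/-- A constant family times a class-supported family. [cite: Hazama1983, §3 (p. 306)] -/
theorem GluedWitness.const_mul_clsInd (i₀ : ι) (C A : Matrix (Fin 2) (Fin 2) ℂ) :
    ((fun _ : ι => C) * fun k => if cls k = cls i₀ then A else 0) = fun k => if cls k = cls i₀ then C * A else 0 := by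
  funext k
  simp only [Pi.mul_apply]
  split_ifs <;> simp

/-- A class-supported family times a constant family. [cite: Hazama1983, §3 (p. 306)] -/
theorem GluedWitness.clsInd_mul_const (i₀ : ι) (A C : Matrix (Fin 2) (Fin 2) ℂ) :
    ((fun k => if cls k = cls i₀ then A else 0) * fun _ : ι => C) = fun k => if cls k = cls i₀ then A * C else 0 := by
  funext k
  simp only [Pi.mul_apply]
  split_ifs <;> simp

/-- Linearity of class-supported families: scalar multiples. [cite: Hazama1983, §3 (p. 306)] -/
theorem GluedWitness.clsInd_smul (i₀ : ι) (c : ℂ) (A : Matrix (Fin 2) (Fin 2) ℂ) :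
    (c • fun k => if cls k = cls i₀ then A else 0) = fun k => if cls k = cls i₀ then c • A else 0 := by
  funext k
  simp only [Pi.smul_apply]
  split_ifs <;> simp

/-- Linearity of class-supported families: sums. [cite: Hazama1983, §3 (p. 306)] -/
theorem GluedWitness.clsInd_add (i₀ : ι) (A B : Matrix (Fin 2) (Fin 2) ℂ) :
    ((fun k => if cls k = cls i₀ then A else 0) + fun k => if cls k = cls i₀ then B else 0) =
      fun k => if cls k = cls i₀ then A + B else 0 := by
  funext k
  simp only [Pi.add_apply]
  split_ifs <;> simp

/-- Linearity of class-supported families: differences. [cite: Hazama1983, §3 (p. 306)] -/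
theorem GluedWitness.clsInd_sub (i₀ : ι) (A B : Matrix (Fin 2) (Fin 2) ℂ) :
    ((fun k => if cls k = cls i₀ then A else 0) - fun k => if cls k = cls i₀ then B else 0) =
      fun k => if cls k = cls i₀ then A - B else 0 := by
  funext k
  simp only [Pi.sub_apply]
  split_ifs <;> simp

/-- Linearity of class-supported families: negation. [cite: Hazama1983, §3 (p. 306)] -/
theorem GluedWitness.clsInd_neg (i₀ : ι) (A : Matrix (Fin 2) (Fin 2) ℂ) :
    (-fun k => if cls k = cls i₀ then A else 0) = fun k => if cls k = cls i₀ then -A else 0 := by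
  funext k
  simp only [Pi.neg_apply]
  split_ifs <;> simp

/-- **A family of blocks constant on the classes of an idempotent class map is the sum of its class-supported
parts**: `F = ∑_{c : cls c = c} 𝟙_{class of c} · F c`. [cite: Hazama1983, §3 (p. 306)] -/
theorem GluedWitness.eq_sum_clsInd [Fintype ι] (hcls : ∀ k, cls (cls k) = cls k) (F : ι → Matrix (Fin 2) (Fin 2) ℂ)
    (hF : ∀ k k', cls k = cls k' → F k = F k') :
    F = ∑ c ∈ Finset.univ.filter (fun c => cls c = c), fun k => if cls k = cls c then F c else 0 := by
  funext k
  rw [Finset.sum_apply, Finset.sum_eq_single (cls k)]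
  · show F k = if cls k = cls (cls k) then F (cls k) else 0
    rw [hcls k, if_pos rfl]
    exact hF k (cls k) (hcls k).symm
  · intro c hc hck
    rw [Finset.mem_filter] at hc
    show (if cls k = cls c then F c else 0) = 0
    rw [if_neg]
    intro h
    exact hck (by rw [← hc.2, h])
  · intro h
    exact absurd ((Finset.mem_filter (p := fun c => cls c = c)).2 ⟨Finset.mem_univ _, hcls k⟩) h

end Matrices

/-! ### §1 The glued class algebra `𝔰 = ⊕_{classes} 𝔰𝔩₂`: membership of assembled families, brackets, the Hodge operator -/

section GluedAlgebra


variable {M : Type*} [AddCommGroup M] [Module ℂ M]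
variable {ι : Type*} [Fintype ι] [DecidableEq ι] {T : ι → Submodule ℂ M}
  (hint : DirectSum.IsInternal T) (b : ∀ i, Module.Basis (Fin 2) ℂ (T i)) (cls : ι → ι)

/-- **Assembled class-constant trace-free families lie in the glued algebra** `𝔰` (given by its membership
predicate: block-preserving, trace-free blocks, equal blocks along each class). [cite: Hazama1983, §3 (p. 306)]
[cite: MoonenZarhin1999LowDim, (2.2) and §3 (3.1)] -/
theorem GluedWitness.assemble_mem (𝔰 : Submodule ℂ (Module.End ℂ M))
    (h𝔰 : ∀ Y, Y ∈ 𝔰 ↔ (∀ i, Set.MapsTo Y (T i) (T i)) ∧ (∀ k, (blockMat hint b Y k).trace = 0) ∧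
      (∀ k k', cls k = cls k' → blockMat hint b Y k = blockMat hint b Y k'))
    (F : ι → Matrix (Fin 2) (Fin 2) ℂ) (htr : ∀ k, (F k).trace = 0) (hF : ∀ k k', cls k = cls k' → F k = F k') :
    assemble hint b F ∈ 𝔰 := by
  refine (h𝔰 _).2 ⟨assemble_mapsTo hint b F, fun k => ?_, fun k k' hkk' => ?_⟩
  · rw [blockMat_assemble]; exact htr k
  · rw [blockMat_assemble]; exact hF k k' hkk'

/-- A class-supported trace-free family assembles to an element of `𝔰`. [cite: Hazama1983, §3 (p. 306)] -/
theorem GluedWitness.assemble_clsInd_mem (𝔰 : Submodule ℂ (Module.End ℂ M))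
    (h𝔰 : ∀ Y, Y ∈ 𝔰 ↔ (∀ i, Set.MapsTo Y (T i) (T i)) ∧ (∀ k, (blockMat hint b Y k).trace = 0) ∧
      (∀ k k', cls k = cls k' → blockMat hint b Y k = blockMat hint b Y k'))
    (i₀ : ι) (N : Matrix (Fin 2) (Fin 2) ℂ) (hN : N.trace = 0) :
    assemble hint b (fun k => if cls k = cls i₀ then N else 0) ∈ 𝔰 := by
  refine GluedWitness.assemble_mem hint b cls 𝔰 h𝔰 _ (fun k => ?_) (fun k k' hkk' => ?_)
  · show (if cls k = cls i₀ then N else 0).trace = 0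
    split_ifs
    · exact hN
    · exact Matrix.trace_zero _ _
  · show (if cls k = cls i₀ then N else 0) = if cls k' = cls i₀ then N else 0
    rw [hkk']

/-- An element of `𝔰` is the assembled family of its blocks. [cite: Hazama1983, §3 (p. 305)] -/
theorem GluedWitness.eq_assemble_blockMat (𝔰 : Submodule ℂ (Module.End ℂ M))
    (h𝔰 : ∀ Y, Y ∈ 𝔰 ↔ (∀ i, Set.MapsTo Y (T i) (T i)) ∧ (∀ k, (blockMat hint b Y k).trace = 0) ∧
      (∀ k k', cls k = cls k' → blockMat hint b Y k = blockMat hint b Y k'))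
    {Y : Module.End ℂ M} (hY : Y ∈ 𝔰) : Y = assemble hint b (blockMat hint b Y) :=
  (assemble_blockMat hint b ((h𝔰 Y).1 hY).1).symm

/-- Brackets of assembled families are assembled brackets. [cite: Hazama1983, §3 (p. 306)] -/
theorem GluedWitness.assemble_bracket (F G : ι → Matrix (Fin 2) (Fin 2) ℂ) :
    assemble hint b F * assemble hint b G - assemble hint b G * assemble hint b F = assemble hint b (F * G - G * F) := by
  rw [map_sub, assemble_mul, assemble_mul]

/-- **The Hodge operator of an adapted block basis is the assembled constant family `h = diag(1,-1)`**: if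
`Θ (b k 0) = b k 0` and `Θ (b k 1) = -(b k 1)` on every block. [cite: Hazama1983, §3 (pp. 305–306)]
[cite: Deligne1982HodgeCycles, I §3 (proof of Prop. 3.4)] -/
theorem GluedWitness.theta_eq_assemble {Θ : Module.End ℂ M} (h0 : ∀ k, Θ (b k 0) = b k 0)
    (h1 : ∀ k, Θ (b k 1) = -(b k 1 : M)) : Θ = assemble hint b (fun _ => (Matrix.diagonal ![(1 : ℂ), -1])) := by
  refine (hint.collectedBasis b).ext fun ⟨k, c⟩ => ?_
  rw [DirectSum.IsInternal.collectedBasis_coe]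
  change Θ (b k c) = assemble hint b (fun _ => (Matrix.diagonal ![(1 : ℂ), -1])) (b k c)
  rw [assemble_apply_basis, Fin.sum_univ_two]
  fin_cases c
  · simp [h0 k]
  · simp [h1 k]

/-- The assembled class-supported `e` raises: `e_c (b k 1) = b k 0` on the blocks of the class.
[cite: Hazama1983, §3 (p. 306)] -/
theorem GluedWitness.assemble_clsInd_sE_apply_one (i₀ k : ι) (hk : cls k = cls i₀) :
    assemble hint b (fun j => if cls j = cls i₀ then (Matrix.single (0 : Fin 2) (1 : Fin 2) (1 : ℂ)) else 0) (b k 1) = b k 0 := by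
  rw [assemble_apply_basis, Fin.sum_univ_two]
  simp [hk, Matrix.single]

/-- The assembled class-supported `f` lowers: `f_c (b k 0) = b k 1` on the blocks of the class.
[cite: Hazama1983, §3 (p. 306)] -/
theorem GluedWitness.assemble_clsInd_sF_apply_zero (i₀ k : ι) (hk : cls k = cls i₀) :
    assemble hint b (fun j => if cls j = cls i₀ then (Matrix.single (1 : Fin 2) (0 : Fin 2) (1 : ℂ)) else 0) (b k 0) = b k 1 := by
  rw [assemble_apply_basis, Fin.sum_univ_two]
  simp [hk, Matrix.single]

/-- The assembled constant `h` on the basis: `h (b k 0) = b k 0`. [cite: Hazama1983, §3 (p. 306)] -/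
theorem GluedWitness.assemble_sH_apply_zero (k : ι) :
    assemble hint b (fun _ => (Matrix.diagonal ![(1 : ℂ), -1])) (b k 0) = b k 0 := by
  rw [assemble_apply_basis, Fin.sum_univ_two]
  simp

/-- The assembled constant `h` on the basis: `h (b k 1) = -b k 1`. [cite: Hazama1983, §3 (p. 306)] -/
theorem GluedWitness.assemble_sH_apply_one (k : ι) :
    assemble hint b (fun _ => (Matrix.diagonal ![(1 : ℂ), -1])) (b k 1) = -(b k 1 : M) := by
  rw [assemble_apply_basis, Fin.sum_univ_two]
  simp


omit [Fintype ι] in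
/-- A family vanishing on a class commutes (blockwise) with every family supported on that class.
[cite: Hazama1983, §3 (p. 306)] -/
theorem GluedWitness.family_bracket_clsInd_eq_zero (i₀ : ι) (P : ι → Matrix (Fin 2) (Fin 2) ℂ)
    (hP : ∀ k, cls k = cls i₀ → P k = 0) (Q : Matrix (Fin 2) (Fin 2) ℂ) :
    (P * fun k => if cls k = cls i₀ then Q else 0) - (fun k => if cls k = cls i₀ then Q else 0) * P = 0 := by
  funext k
  simp only [Pi.sub_apply, Pi.mul_apply, Pi.zero_apply]
  split_ifs with h
  · rw [hP k h, zero_mul, mul_zero, sub_zero]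
  · rw [mul_zero, zero_mul, sub_zero]

omit [Fintype ι] [DecidableEq ι] in
/-- `[h-constant family, c • X family] = c • [h, X]` blockwise. [cite: Hazama1983, §3 (p. 306)] -/
theorem GluedWitness.const_bracket_smul_family (C X : Matrix (Fin 2) (Fin 2) ℂ) (c : ι → ℂ) :
    ((fun _ : ι => C) * (fun k => c k • X) - (fun k => c k • X) * fun _ : ι => C) =
      fun k => c k • (C * X - X * C) := by
  funext k
  simp only [Pi.sub_apply, Pi.mul_apply, smul_sub, mul_smul_comm, smul_mul_assoc]

/-- A lowering operator kills the `-1`-eigenvectors of the involution (`A Θ = A`, `Θ u = -u` ⟹ `A u = 0`).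
[cite: GoodmanWallachGTM255, §4.1.1] -/
theorem GluedWitness.apply_eq_zero_of_lower {W : Type*} [AddCommGroup W] [Module ℂ W] {Θ A : Module.End ℂ W}
    (hA : A * Θ = A) {u : W} (hu : Θ u = -u) : A u = 0 := by
  have h : A u = -A u := by
    conv_lhs => rw [← hA, Module.End.mul_apply, hu, map_neg]
  have h2 : (2 : ℂ) • A u = 0 := by rw [two_smul]; nth_rewrite 2 [h]; exact add_neg_cancel _
  exact (smul_eq_zero.1 h2).resolve_left two_ne_zero

end GluedAlgebra

/-! ### §2 The witness: in a faithful `Θ`-graded representation of the glued algebra the standard representation of one block occurs; equivariant maps are morphisms of Hodge structures -/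

section Witness


variable {M W : Type*} [AddCommGroup M] [Module ℂ M] [AddCommGroup W] [Module ℂ W]
variable {ι : Type*} [Fintype ι] [DecidableEq ι] {T : ι → Submodule ℂ M}
  (hint : DirectSum.IsInternal T) (b : ∀ i, Module.Basis (Fin 2) ℂ (T i)) (cls : ι → ι)

/-- The raising relation `[h, e_c] = 2 e_c` for the assembled class-supported `e`. [cite: GoodmanWallachGTM255, §2.5.3] -/
theorem GluedWitness.sH_bracket_clsInd_sE (i₀ : ι) :
    assemble hint b (fun _ => (Matrix.diagonal ![(1 : ℂ), -1])) * assemble hint b (fun k => if cls k = cls i₀ then (Matrix.single (0 : Fin 2) (1 : Fin 2) (1 : ℂ)) else 0) -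
        assemble hint b (fun k => if cls k = cls i₀ then (Matrix.single (0 : Fin 2) (1 : Fin 2) (1 : ℂ)) else 0) * assemble hint b (fun _ => (Matrix.diagonal ![(1 : ℂ), -1])) =
      (2 : ℂ) • assemble hint b (fun k => if cls k = cls i₀ then (Matrix.single (0 : Fin 2) (1 : Fin 2) (1 : ℂ)) else 0) := by
  rw [GluedWitness.assemble_bracket, GluedWitness.const_mul_clsInd, GluedWitness.clsInd_mul_const,
    GluedWitness.clsInd_sub, GluedWitness.sH_mul_sE_sub, ← GluedWitness.clsInd_smul, map_smul]

/-- The lowering relation `[h, f_c] = -2 f_c` for the assembled class-supported `f`. [cite: GoodmanWallachGTM255, §2.5.3] -/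
theorem GluedWitness.sH_bracket_clsInd_sF (i₀ : ι) :
    assemble hint b (fun _ => (Matrix.diagonal ![(1 : ℂ), -1])) * assemble hint b (fun k => if cls k = cls i₀ then (Matrix.single (1 : Fin 2) (0 : Fin 2) (1 : ℂ)) else 0) -
        assemble hint b (fun k => if cls k = cls i₀ then (Matrix.single (1 : Fin 2) (0 : Fin 2) (1 : ℂ)) else 0) * assemble hint b (fun _ => (Matrix.diagonal ![(1 : ℂ), -1])) =
      -((2 : ℂ) • assemble hint b (fun k => if cls k = cls i₀ then (Matrix.single (1 : Fin 2) (0 : Fin 2) (1 : ℂ)) else 0)) := by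
  rw [GluedWitness.assemble_bracket, GluedWitness.const_mul_clsInd, GluedWitness.clsInd_mul_const,
    GluedWitness.clsInd_sub, GluedWitness.sH_mul_sF_sub, ← GluedWitness.clsInd_neg, ← GluedWitness.clsInd_smul,
    map_neg, map_smul]

/-- **Equivariant maps intertwine the gradings** (Moonen–Zarhin (3.3)/(3.4): the `𝔤₃`-equivariant part of
`Hom(V_{X₂}, V_{X₁})` consists of morphisms of Hodge structures). For the glued algebra `𝔰` of `(T, b, cls)`, a
linear `ρ : End M → End W` with `ρ[h, Y] = [Θ, ρY]` (`Y ∈ 𝔰`, `Θ² = 1`), every `f : M → W` with `ρ(Y) f = f Y` for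
all `Y ∈ 𝔰` satisfies `Θ f = f h`: `b k 0 = e_c (b k 1)` and `ρ(e_c)` is `Θ`-raising, `b k 1 = f_c (b k 0)` and `ρ(f_c)`
is `Θ`-lowering. [cite: MoonenZarhin1999LowDim, §3 Lemma (3.3) and Lemma (3.4)] [cite: GoodmanWallachGTM255, §4.1.1] -/
theorem GluedWitness.theta_comp_eq_of_equivariant (𝔰 : Submodule ℂ (Module.End ℂ M))
    (h𝔰 : ∀ Y, Y ∈ 𝔰 ↔ (∀ i, Set.MapsTo Y (T i) (T i)) ∧ (∀ k, (blockMat hint b Y k).trace = 0) ∧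
      (∀ k k', cls k = cls k' → blockMat hint b Y k = blockMat hint b Y k'))
    {Θ : Module.End ℂ W} (hΘΘ : ∀ w, Θ (Θ w) = w) (ρ : Module.End ℂ M →ₗ[ℂ] Module.End ℂ W)
    (hρΘ : ∀ Y ∈ 𝔰, ρ (assemble hint b (fun _ => (Matrix.diagonal ![(1 : ℂ), -1])) * Y - Y * assemble hint b (fun _ => (Matrix.diagonal ![(1 : ℂ), -1]))) = Θ * ρ Y - ρ Y * Θ)
    (f : M →ₗ[ℂ] W) (hf : ∀ Y ∈ 𝔰, ρ Y ∘ₗ f = f ∘ₗ Y) :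
    Θ ∘ₗ f = f ∘ₗ assemble hint b (fun _ => (Matrix.diagonal ![(1 : ℂ), -1])) := by
  have hΘ2 : Θ * Θ = 1 := LinearMap.ext fun w => by rw [Module.End.mul_apply, hΘΘ, Module.End.one_apply]
  refine (hint.collectedBasis b).ext fun ⟨k, c⟩ => ?_
  rw [DirectSum.IsInternal.collectedBasis_coe]
  change Θ (f (b k c)) = f (assemble hint b (fun _ => (Matrix.diagonal ![(1 : ℂ), -1])) (b k c))
  -- the class operators of `k`
  have he𝔰 := GluedWitness.assemble_clsInd_mem hint b cls 𝔰 h𝔰 k (Matrix.single (0 : Fin 2) (1 : Fin 2) (1 : ℂ)) GluedWitness.trace_sE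
  have hf𝔰 := GluedWitness.assemble_clsInd_mem hint b cls 𝔰 h𝔰 k (Matrix.single (1 : Fin 2) (0 : Fin 2) (1 : ℂ)) GluedWitness.trace_sF
  have hE : Θ * ρ (assemble hint b (fun j => if cls j = cls k then (Matrix.single (0 : Fin 2) (1 : Fin 2) (1 : ℂ)) else 0)) -
      ρ (assemble hint b (fun j => if cls j = cls k then (Matrix.single (0 : Fin 2) (1 : Fin 2) (1 : ℂ)) else 0)) * Θ =
      (2 : ℂ) • ρ (assemble hint b (fun j => if cls j = cls k then (Matrix.single (0 : Fin 2) (1 : Fin 2) (1 : ℂ)) else 0)) := by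
    rw [← hρΘ _ he𝔰, GluedWitness.sH_bracket_clsInd_sE, map_smul]
  have hF : Θ * ρ (assemble hint b (fun j => if cls j = cls k then (Matrix.single (1 : Fin 2) (0 : Fin 2) (1 : ℂ)) else 0)) -
      ρ (assemble hint b (fun j => if cls j = cls k then (Matrix.single (1 : Fin 2) (0 : Fin 2) (1 : ℂ)) else 0)) * Θ =
      -((2 : ℂ) • ρ (assemble hint b (fun j => if cls j = cls k then (Matrix.single (1 : Fin 2) (0 : Fin 2) (1 : ℂ)) else 0))) := by
    rw [← hρΘ _ hf𝔰, GluedWitness.sH_bracket_clsInd_sF, map_neg, map_smul]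
  obtain ⟨hΘE, -⟩ := SymplecticWitness.theta_mul_of_bracket_eq_two_smul hΘ2 hE
  obtain ⟨hΘF, -⟩ := SymplecticWitness.theta_mul_of_bracket_eq_neg_two_smul hΘ2 hF
  fin_cases c
  · -- `b k 0 = e_k (b k 1)`
    have hb : (b k 0 : M) = assemble hint b (fun j => if cls j = cls k then (Matrix.single (0 : Fin 2) (1 : Fin 2) (1 : ℂ)) else 0) (b k 1) :=
      (GluedWitness.assemble_clsInd_sE_apply_one hint b cls k k rfl).symm
    change Θ (f (b k 0)) = f (assemble hint b (fun _ => (Matrix.diagonal ![(1 : ℂ), -1])) (b k 0))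
    rw [GluedWitness.assemble_sH_apply_zero, hb, ← LinearMap.comp_apply (f := f), ← hf _ he𝔰, LinearMap.comp_apply,
      ← Module.End.mul_apply (f := Θ), hΘE]
  · have hb : (b k 1 : M) = assemble hint b (fun j => if cls j = cls k then (Matrix.single (1 : Fin 2) (0 : Fin 2) (1 : ℂ)) else 0) (b k 0) :=
      (GluedWitness.assemble_clsInd_sF_apply_zero hint b cls k k rfl).symm
    change Θ (f (b k 1)) = f (assemble hint b (fun _ => (Matrix.diagonal ![(1 : ℂ), -1])) (b k 1))
    rw [GluedWitness.assemble_sH_apply_one, map_neg, hb, ← LinearMap.comp_apply (f := f), ← hf _ hf𝔰,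
      LinearMap.comp_apply, ← Module.End.mul_apply (f := Θ), hΘF, LinearMap.neg_apply]

/-- The bracket `[h_c, e_c] = 2 e_c` of the class operators. [cite: GoodmanWallachGTM255, §2.5.3] -/
theorem GluedWitness.clsInd_sH_bracket_clsInd_sE (i₀ : ι) :
    assemble hint b (fun k => if cls k = cls i₀ then (Matrix.diagonal ![(1 : ℂ), -1]) else 0) * assemble hint b (fun k => if cls k = cls i₀ then (Matrix.single (0 : Fin 2) (1 : Fin 2) (1 : ℂ)) else 0) -
        assemble hint b (fun k => if cls k = cls i₀ then (Matrix.single (0 : Fin 2) (1 : Fin 2) (1 : ℂ)) else 0) * assemble hint b (fun k => if cls k = cls i₀ then (Matrix.diagonal ![(1 : ℂ), -1]) else 0) =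
      (2 : ℂ) • assemble hint b (fun k => if cls k = cls i₀ then (Matrix.single (0 : Fin 2) (1 : Fin 2) (1 : ℂ)) else 0) := by
  rw [GluedWitness.assemble_bracket, GluedWitness.clsInd_mul_clsInd, GluedWitness.clsInd_mul_clsInd,
    GluedWitness.clsInd_sub, GluedWitness.sH_mul_sE_sub, ← GluedWitness.clsInd_smul, map_smul]

/-- The bracket `[e_c, f_c] = h_c` of the class operators. [cite: GoodmanWallachGTM255, §2.5.3] -/
theorem GluedWitness.clsInd_sE_bracket_clsInd_sF (i₀ : ι) :
    assemble hint b (fun k => if cls k = cls i₀ then (Matrix.single (0 : Fin 2) (1 : Fin 2) (1 : ℂ)) else 0) * assemble hint b (fun k => if cls k = cls i₀ then (Matrix.single (1 : Fin 2) (0 : Fin 2) (1 : ℂ)) else 0) -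
        assemble hint b (fun k => if cls k = cls i₀ then (Matrix.single (1 : Fin 2) (0 : Fin 2) (1 : ℂ)) else 0) * assemble hint b (fun k => if cls k = cls i₀ then (Matrix.single (0 : Fin 2) (1 : Fin 2) (1 : ℂ)) else 0) =
      assemble hint b (fun k => if cls k = cls i₀ then (Matrix.diagonal ![(1 : ℂ), -1]) else 0) := by
  rw [GluedWitness.assemble_bracket, GluedWitness.clsInd_mul_clsInd, GluedWitness.clsInd_mul_clsInd,
    GluedWitness.clsInd_sub, GluedWitness.sE_mul_sF_sub]

/-- The assembled class-supported `e` is non-zero (its block at `i₀` is `e ≠ 0`). [cite: Hazama1983, §3 (p. 306)] -/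
theorem GluedWitness.assemble_clsInd_sE_ne_zero (i₀ : ι) :
    assemble hint b (fun k => if cls k = cls i₀ then (Matrix.single (0 : Fin 2) (1 : Fin 2) (1 : ℂ)) else 0) ≠ 0 := by
  intro h
  have hb := congrFun (blockMat_assemble hint b (fun k => if cls k = cls i₀ then (Matrix.single (0 : Fin 2) (1 : Fin 2) (1 : ℂ)) else 0)) i₀
  rw [h, map_zero, Pi.zero_apply] at hb
  simp only [if_true] at hb
  exact GluedWitness.sE_ne_zero hb.symm

set_option maxHeartbeats 400000 in
/-- **The witness: the standard representation of one block occurs (Moonen–Zarhin Lemma (3.4), «`V_{X₂}` is the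
only irreducible `hg(X₂)`-module which is a length 1 representation of non-compact type», in elementary form for a
glued `⊕_{classes} 𝔰𝔩₂`).** Let `𝔰 ⊆ End_ℂ(M)` be the glued class algebra of `(T, b, cls)` (block-preserving,
trace-free blocks, equal blocks along each class), `h = ⊕ diag(1,-1)` its Hodge operator, and let
`ρ : End M → End W` be linear, bracket-preserving on `𝔰`, with `ρ[h, Y] = [Θ, ρY]` for an involution `Θ` of `W`,
and injective on `𝔰`. Then there is a non-zero `F : M → W` with `ρ(Y) F = F Y` for all `Y ∈ 𝔰`. CONSTRUCTION: for
the class `c` of `i₀`, `E = ρ(e_c) ≠ 0`, `F' = ρ(f_c)` are `Θ`-raising / -lowering, so `E² = F'² = 0`, `E F' E = E`;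
pick `u` with `Θu = -u`, `Eu ≠ 0`, and send `b i₀ 0 ↦ Eu`, `b i₀ 1 ↦ F'Eu`, all other block vectors to `0`. For
`Y ∈ 𝔰`, `Y = Y_c + Y'` with `Y_c = 𝟙_c · (blockMat Y)_{i₀} = N₀₁ e_c + N₁₀ f_c + N₀₀ h_c` and `Y'` vanishing on the
class `c`; `ρ(Y_c)` acts on `⟨Eu, F'Eu⟩` by the matrix `N`, and `ρ(Y') = R₊ + R₋ + [A, B]` (raising / lowering parts,
the Cartan part written as a bracket of a raising `A` and a lowering `B`, all commuting with `E`, `F'`) kills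
`Eu` and `F'Eu` by `Θ`-weights. [cite: MoonenZarhin1999LowDim, §3 Lemma (3.3) and Lemma (3.4)]
[cite: Hazama1983, §3 (p. 306)] [cite: GoodmanWallachGTM255, §4.1.1] -/
theorem GluedWitness.exists_equivariant_ne_zero (i₀ : ι) (𝔰 : Submodule ℂ (Module.End ℂ M))
    (h𝔰 : ∀ Y, Y ∈ 𝔰 ↔ (∀ i, Set.MapsTo Y (T i) (T i)) ∧ (∀ k, (blockMat hint b Y k).trace = 0) ∧
      (∀ k k', cls k = cls k' → blockMat hint b Y k = blockMat hint b Y k'))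
    {Θ : Module.End ℂ W} (hΘΘ : ∀ w, Θ (Θ w) = w) (ρ : Module.End ℂ M →ₗ[ℂ] Module.End ℂ W)
    (hρbr : ∀ Y ∈ 𝔰, ∀ Y' ∈ 𝔰, ρ (Y * Y' - Y' * Y) = ρ Y * ρ Y' - ρ Y' * ρ Y)
    (hρΘ : ∀ Y ∈ 𝔰, ρ (assemble hint b (fun _ => (Matrix.diagonal ![(1 : ℂ), -1])) * Y - Y * assemble hint b (fun _ => (Matrix.diagonal ![(1 : ℂ), -1]))) = Θ * ρ Y - ρ Y * Θ)
    (hinj : ∀ Y ∈ 𝔰, ρ Y = 0 → Y = 0) :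
    ∃ F : M →ₗ[ℂ] W, F ≠ 0 ∧ ∀ Y ∈ 𝔰, ρ Y ∘ₗ F = F ∘ₗ Y := by
  classical
  have hΘ2 : Θ * Θ = 1 := LinearMap.ext fun w => by rw [Module.End.mul_apply, hΘΘ, Module.End.one_apply]
  -- the class operators `e_c, f_c, h_c` of the class of `i₀`
  obtain ⟨eOp, heOp⟩ : ∃ X, X = assemble hint b (fun k => if cls k = cls i₀ then (Matrix.single (0 : Fin 2) (1 : Fin 2) (1 : ℂ)) else 0) := ⟨_, rfl⟩
  obtain ⟨fOp, hfOp⟩ : ∃ X, X = assemble hint b (fun k => if cls k = cls i₀ then (Matrix.single (1 : Fin 2) (0 : Fin 2) (1 : ℂ)) else 0) := ⟨_, rfl⟩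
  obtain ⟨hOp, hhOp⟩ : ∃ X, X = assemble hint b (fun k => if cls k = cls i₀ then (Matrix.diagonal ![(1 : ℂ), -1]) else 0) := ⟨_, rfl⟩
  have he𝔰 : eOp ∈ 𝔰 := heOp ▸ GluedWitness.assemble_clsInd_mem hint b cls 𝔰 h𝔰 i₀ (Matrix.single (0 : Fin 2) (1 : Fin 2) (1 : ℂ)) GluedWitness.trace_sE
  have hf𝔰 : fOp ∈ 𝔰 := hfOp ▸ GluedWitness.assemble_clsInd_mem hint b cls 𝔰 h𝔰 i₀ (Matrix.single (1 : Fin 2) (0 : Fin 2) (1 : ℂ)) GluedWitness.trace_sF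
  have hh𝔰 : hOp ∈ 𝔰 := hhOp ▸ GluedWitness.assemble_clsInd_mem hint b cls 𝔰 h𝔰 i₀ (Matrix.diagonal ![(1 : ℂ), -1]) GluedWitness.trace_sH
  have hTe : assemble hint b (fun _ => (Matrix.diagonal ![(1 : ℂ), -1])) * eOp - eOp * assemble hint b (fun _ => (Matrix.diagonal ![(1 : ℂ), -1])) = (2 : ℂ) • eOp := by
    rw [heOp]; exact GluedWitness.sH_bracket_clsInd_sE hint b cls i₀
  have hTf : assemble hint b (fun _ => (Matrix.diagonal ![(1 : ℂ), -1])) * fOp - fOp * assemble hint b (fun _ => (Matrix.diagonal ![(1 : ℂ), -1])) = -((2 : ℂ) • fOp) := by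
    rw [hfOp]; exact GluedWitness.sH_bracket_clsInd_sF hint b cls i₀
  have hef : eOp * fOp - fOp * eOp = hOp := by
    rw [heOp, hfOp, hhOp]; exact GluedWitness.clsInd_sE_bracket_clsInd_sF hint b cls i₀
  have hhe : hOp * eOp - eOp * hOp = (2 : ℂ) • eOp := by
    rw [heOp, hhOp]; exact GluedWitness.clsInd_sH_bracket_clsInd_sE hint b cls i₀
  -- their images `E, F', Hw`
  obtain ⟨E, hEdef⟩ : ∃ X, X = ρ eOp := ⟨_, rfl⟩
  obtain ⟨F', hFdef⟩ : ∃ X, X = ρ fOp := ⟨_, rfl⟩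
  obtain ⟨Hw, hHwdef⟩ : ∃ X, X = ρ hOp := ⟨_, rfl⟩
  have hΘE : Θ * E - E * Θ = (2 : ℂ) • E := by rw [hEdef, ← hρΘ _ he𝔰, hTe, map_smul]
  have hΘF : Θ * F' - F' * Θ = -((2 : ℂ) • F') := by rw [hFdef, ← hρΘ _ hf𝔰, hTf, map_neg, map_smul]
  obtain ⟨hΘE1, hEΘ⟩ := SymplecticWitness.theta_mul_of_bracket_eq_two_smul hΘ2 hΘE
  obtain ⟨hΘF1, hFΘ⟩ := SymplecticWitness.theta_mul_of_bracket_eq_neg_two_smul hΘ2 hΘF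
  have hEE : E * E = 0 := SymplecticWitness.mul_eq_zero_of_raise hEΘ hΘE1
  have hFF : F' * F' = 0 := SymplecticWitness.mul_eq_zero_of_lower hFΘ hΘF1
  have hHw : Hw = E * F' - F' * E := by rw [hHwdef, hEdef, hFdef, ← hρbr _ he𝔰 _ hf𝔰, hef]
  have hHE : Hw * E - E * Hw = (2 : ℂ) • E := by rw [hHwdef, hEdef, ← hρbr _ hh𝔰 _ he𝔰, hhe, map_smul]
  have hEFE : E * F' * E = E := by
    have h2 : (2 : ℂ) • (E * F' * E) = (2 : ℂ) • E := by
      rw [← hHE, hHw, sub_mul, mul_sub, mul_assoc F' E E, hEE, mul_zero, sub_zero, ← mul_assoc E E F',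
        hEE, zero_mul, zero_sub, sub_neg_eq_add, ← mul_assoc, two_smul]
    exact smul_right_injective _ (two_ne_zero (α := ℂ)) h2
  have hHwE : Hw * E = E := by rw [hHw, sub_mul, hEFE, mul_assoc, hEE, mul_zero, sub_zero]
  have hHwFE : Hw * (F' * E) = -(F' * E) := by
    rw [hHw, sub_mul, ← mul_assoc, mul_assoc E F' F', hFF, mul_zero, zero_mul, zero_sub, mul_assoc, ← mul_assoc,
      ← mul_assoc, mul_assoc F' E F', ← mul_assoc, show F' * E * F' * E = F' * (E * F' * E) by noncomm_ring, hEFE]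
  -- `E ≠ 0`; a vector `u` with `Θu = -u`, `Eu ≠ 0`
  have hE0 : E ≠ 0 := by
    intro h
    rw [hEdef] at h
    exact (heOp ▸ GluedWitness.assemble_clsInd_sE_ne_zero hint b cls i₀) (hinj _ he𝔰 h)
  obtain ⟨v, hv⟩ : ∃ v, E v ≠ 0 := by
    by_contra h
    simp only [not_exists, not_not] at h
    exact hE0 (LinearMap.ext fun w => by rw [h w, LinearMap.zero_apply])
  obtain ⟨u, hudef⟩ : ∃ u : W, u = (2 : ℂ)⁻¹ • (v - Θ v) := ⟨_, rfl⟩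
  have hΘu : Θ u = -u := by
    rw [hudef, map_smul, map_sub, hΘΘ, ← smul_neg, neg_sub]
  have hEu : E u = E v := by
    rw [hudef, map_smul, map_sub, ← Module.End.mul_apply (f := E), hEΘ, LinearMap.neg_apply, sub_neg_eq_add,
      ← two_smul ℂ, smul_smul, inv_mul_cancel₀ (two_ne_zero (α := ℂ)), one_smul]
  have hEu0 : E u ≠ 0 := by rw [hEu]; exact hv
  -- the map `F : b i₀ 0 ↦ Eu, b i₀ 1 ↦ F'Eu`, other block vectors `↦ 0`
  set Fm : M →ₗ[ℂ] W := (hint.collectedBasis b).constr ℂ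
    (fun j : Σ i, Fin 2 => if j.1 = i₀ then (if j.2 = 0 then E u else F' (E u)) else 0) with hFmdef
  have hFm : ∀ k c, Fm (b k c) = if k = i₀ then (if c = 0 then E u else F' (E u)) else 0 := by
    intro k c
    have hbk : (b k c : M) = hint.collectedBasis b ⟨k, c⟩ := by rw [DirectSum.IsInternal.collectedBasis_coe]
    rw [hbk, hFmdef, Module.Basis.constr_basis]
  refine ⟨Fm, fun h0 => hEu0 ?_, fun Y hY => ?_⟩
  · have h := hFm i₀ 0
    rw [h0, LinearMap.zero_apply, if_pos rfl, if_pos rfl] at h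
    exact h.symm
  -- EQUIVARIANCE for `Y ∈ 𝔰`
  obtain ⟨hYmaps, hYtr, hYcls⟩ := (h𝔰 Y).1 hY
  -- `Y = Y_c + Y'`
  set N : Matrix (Fin 2) (Fin 2) ℂ := blockMat hint b Y i₀ with hNdef
  have hNtr : N.trace = 0 := hYtr i₀
  have hN11 : N 1 1 = -N 0 0 := by
    have h := hNtr
    rw [Matrix.trace_fin_two] at h
    linear_combination h
  obtain ⟨Yc, hYc⟩ : ∃ X, X = assemble hint b (fun k => if cls k = cls i₀ then N else 0) := ⟨_, rfl⟩
  have hYc𝔰 : Yc ∈ 𝔰 := hYc ▸ GluedWitness.assemble_clsInd_mem hint b cls 𝔰 h𝔰 i₀ N hNtr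
  have hYceq : Yc = N 0 1 • eOp + N 1 0 • fOp + N 0 0 • hOp := by
    have hfam : (fun k => if cls k = cls i₀ then N else 0) =
        N 0 1 • (fun k => if cls k = cls i₀ then (Matrix.single (0 : Fin 2) (1 : Fin 2) (1 : ℂ)) else 0) + N 1 0 • (fun k => if cls k = cls i₀ then (Matrix.single (1 : Fin 2) (0 : Fin 2) (1 : ℂ)) else 0) +
          N 0 0 • (fun k => if cls k = cls i₀ then (Matrix.diagonal ![(1 : ℂ), -1]) else 0) := by
      rw [GluedWitness.clsInd_smul, GluedWitness.clsInd_smul, GluedWitness.clsInd_smul, GluedWitness.clsInd_add,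
        GluedWitness.clsInd_add, ← GluedWitness.eq_sE_sF_sH_of_trace_eq_zero N hNtr]
    rw [hYc, hfam, map_add, map_add, map_smul, map_smul, map_smul, heOp, hfOp, hhOp]
  have hρYc : ρ Yc = N 0 1 • E + N 1 0 • F' + N 0 0 • Hw := by
    rw [hYceq, map_add, map_add, map_smul, map_smul, map_smul, hEdef, hFdef, hHwdef]
  obtain ⟨Yr, hYr⟩ : ∃ X, X = Y - Yc := ⟨_, rfl⟩
  have hYr𝔰 : Yr ∈ 𝔰 := hYr ▸ Submodule.sub_mem _ hY hYc𝔰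
  obtain ⟨hYrmaps, hYrtr, hYrcls⟩ := (h𝔰 Yr).1 hYr𝔰
  have hYsum : Y = Yc + Yr := by rw [hYr]; abel
  -- the blocks `G` of `Y'` vanish on the class of `i₀`
  set G : ι → Matrix (Fin 2) (Fin 2) ℂ := blockMat hint b Yr with hGdef
  have hG0 : ∀ k, cls k = cls i₀ → G k = 0 := by
    intro k hk
    rw [hGdef, hYr, map_sub, Pi.sub_apply, hYcls k i₀ hk, hYc, blockMat_assemble]
    simp only [hk, if_true]
    exact sub_self _
  have hGtr : ∀ k, (G k).trace = 0 := fun k => hYrtr k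
  have hGcls : ∀ k k', cls k = cls k' → G k = G k' := fun k k' h => hYrcls k k' h
  -- `Y' = Y₊ + Y₋ + [A₀, B₀]`
  obtain ⟨Yp, hYp⟩ : ∃ X, X = assemble hint b (fun k => G k 0 1 • (Matrix.single (0 : Fin 2) (1 : Fin 2) (1 : ℂ))) := ⟨_, rfl⟩
  obtain ⟨Ym, hYm⟩ : ∃ X, X = assemble hint b (fun k => G k 1 0 • (Matrix.single (1 : Fin 2) (0 : Fin 2) (1 : ℂ))) := ⟨_, rfl⟩
  obtain ⟨A₀, hA₀⟩ : ∃ X, X = assemble hint b (fun k => G k 0 0 • (Matrix.single (0 : Fin 2) (1 : Fin 2) (1 : ℂ))) := ⟨_, rfl⟩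
  obtain ⟨B₀, hB₀⟩ : ∃ X, X = assemble hint b (fun k => if cls k = cls i₀ then 0 else (Matrix.single (1 : Fin 2) (0 : Fin 2) (1 : ℂ))) := ⟨_, rfl⟩
  have hYrdec : Yr = Yp + Ym + (A₀ * B₀ - B₀ * A₀) := by
    have hGdec : G = (fun k => G k 0 1 • (Matrix.single (0 : Fin 2) (1 : Fin 2) (1 : ℂ))) + (fun k => G k 1 0 • (Matrix.single (1 : Fin 2) (0 : Fin 2) (1 : ℂ))) +
        ((fun k => G k 0 0 • (Matrix.single (0 : Fin 2) (1 : Fin 2) (1 : ℂ))) * (fun k => if cls k = cls i₀ then 0 else (Matrix.single (1 : Fin 2) (0 : Fin 2) (1 : ℂ))) -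
          (fun k => if cls k = cls i₀ then 0 else (Matrix.single (1 : Fin 2) (0 : Fin 2) (1 : ℂ))) * (fun k => G k 0 0 • (Matrix.single (0 : Fin 2) (1 : Fin 2) (1 : ℂ)))) := by
      funext k
      simp only [Pi.add_apply, Pi.sub_apply, Pi.mul_apply]
      by_cases hk : cls k = cls i₀
      · rw [if_pos hk, hG0 k hk]; simp
      · rw [if_neg hk, smul_mul_assoc, mul_smul_comm, ← smul_sub, GluedWitness.sE_mul_sF_sub]
        exact GluedWitness.eq_sE_sF_sH_of_trace_eq_zero (G k) (hGtr k)
    rw [GluedWitness.eq_assemble_blockMat hint b cls 𝔰 h𝔰 hYr𝔰, ← hGdef, hGdec, map_add, map_add,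
      ← GluedWitness.assemble_bracket, hYp, hYm, hA₀, hB₀]
  -- memberships in `𝔰`
  have hYp𝔰 : Yp ∈ 𝔰 := hYp ▸ GluedWitness.assemble_mem hint b cls 𝔰 h𝔰 _
    (fun k => by rw [Matrix.trace_smul, GluedWitness.trace_sE, smul_zero]) (fun k k' h => by simp only [hGcls k k' h])
  have hYm𝔰 : Ym ∈ 𝔰 := hYm ▸ GluedWitness.assemble_mem hint b cls 𝔰 h𝔰 _
    (fun k => by rw [Matrix.trace_smul, GluedWitness.trace_sF, smul_zero]) (fun k k' h => by simp only [hGcls k k' h])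
  have hA₀𝔰 : A₀ ∈ 𝔰 := hA₀ ▸ GluedWitness.assemble_mem hint b cls 𝔰 h𝔰 _
    (fun k => by rw [Matrix.trace_smul, GluedWitness.trace_sE, smul_zero]) (fun k k' h => by simp only [hGcls k k' h])
  have hB₀𝔰 : B₀ ∈ 𝔰 := hB₀ ▸ GluedWitness.assemble_mem hint b cls 𝔰 h𝔰 _
    (fun k => by
      show (if cls k = cls i₀ then (0 : Matrix (Fin 2) (Fin 2) ℂ) else (Matrix.single (1 : Fin 2) (0 : Fin 2) (1 : ℂ))).trace = 0
      split_ifs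
      · exact Matrix.trace_zero _ _
      · exact GluedWitness.trace_sF)
    (fun k k' h => by simp only [h])
  -- raising / lowering relations of the four pieces
  have hTYp : assemble hint b (fun _ => (Matrix.diagonal ![(1 : ℂ), -1])) * Yp - Yp * assemble hint b (fun _ => (Matrix.diagonal ![(1 : ℂ), -1])) = (2 : ℂ) • Yp := by
    rw [hYp, GluedWitness.assemble_bracket, GluedWitness.const_bracket_smul_family, GluedWitness.sH_mul_sE_sub, ← map_smul]
    congr 1
    funext k
    simp only [Pi.smul_apply, smul_smul, mul_comm]
  have hTA₀ : assemble hint b (fun _ => (Matrix.diagonal ![(1 : ℂ), -1])) * A₀ - A₀ * assemble hint b (fun _ => (Matrix.diagonal ![(1 : ℂ), -1])) = (2 : ℂ) • A₀ := by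
    rw [hA₀, GluedWitness.assemble_bracket, GluedWitness.const_bracket_smul_family, GluedWitness.sH_mul_sE_sub, ← map_smul]
    congr 1
    funext k
    simp only [Pi.smul_apply, smul_smul, mul_comm]
  have hTYm : assemble hint b (fun _ => (Matrix.diagonal ![(1 : ℂ), -1])) * Ym - Ym * assemble hint b (fun _ => (Matrix.diagonal ![(1 : ℂ), -1])) = -((2 : ℂ) • Ym) := by
    rw [hYm, GluedWitness.assemble_bracket, GluedWitness.const_bracket_smul_family, GluedWitness.sH_mul_sF_sub,
      ← map_smul, ← map_neg]
    congr 1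
    funext k
    simp only [Pi.smul_apply, Pi.neg_apply, smul_neg, smul_smul, mul_comm]
  have hTB₀ : assemble hint b (fun _ => (Matrix.diagonal ![(1 : ℂ), -1])) * B₀ - B₀ * assemble hint b (fun _ => (Matrix.diagonal ![(1 : ℂ), -1])) = -((2 : ℂ) • B₀) := by
    rw [hB₀, GluedWitness.assemble_bracket, ← map_smul, ← map_neg]
    congr 1
    funext k
    simp only [Pi.sub_apply, Pi.mul_apply, Pi.smul_apply, Pi.neg_apply]
    split_ifs
    · simp
    · rw [GluedWitness.sH_mul_sF_sub]
  -- images: `R₊ = ρ Y₊`, `R₋ = ρ Y₋`, `A = ρ A₀`, `B = ρ B₀`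
  have hΘRp : Θ * ρ Yp - ρ Yp * Θ = (2 : ℂ) • ρ Yp := by rw [← hρΘ _ hYp𝔰, hTYp, map_smul]
  have hΘA : Θ * ρ A₀ - ρ A₀ * Θ = (2 : ℂ) • ρ A₀ := by rw [← hρΘ _ hA₀𝔰, hTA₀, map_smul]
  have hΘRm : Θ * ρ Ym - ρ Ym * Θ = -((2 : ℂ) • ρ Ym) := by rw [← hρΘ _ hYm𝔰, hTYm, map_neg, map_smul]
  have hΘB : Θ * ρ B₀ - ρ B₀ * Θ = -((2 : ℂ) • ρ B₀) := by rw [← hρΘ _ hB₀𝔰, hTB₀, map_neg, map_smul]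
  obtain ⟨hΘRp1, hRpΘ⟩ := SymplecticWitness.theta_mul_of_bracket_eq_two_smul hΘ2 hΘRp
  obtain ⟨hΘA1, hAΘ⟩ := SymplecticWitness.theta_mul_of_bracket_eq_two_smul hΘ2 hΘA
  obtain ⟨hΘRm1, hRmΘ⟩ := SymplecticWitness.theta_mul_of_bracket_eq_neg_two_smul hΘ2 hΘRm
  obtain ⟨hΘB1, hBΘ⟩ := SymplecticWitness.theta_mul_of_bracket_eq_neg_two_smul hΘ2 hΘB
  -- the four pieces commute with `e_c` and `f_c` (disjoint class supports), hence their images with `E`, `F'`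
  have hcommM : ∀ (P : ι → Matrix (Fin 2) (Fin 2) ℂ), (∀ k, cls k = cls i₀ → P k = 0) →
      ∀ (Q : Matrix (Fin 2) (Fin 2) ℂ), assemble hint b P * assemble hint b (fun k => if cls k = cls i₀ then Q else 0) -
        assemble hint b (fun k => if cls k = cls i₀ then Q else 0) * assemble hint b P = 0 := by
    intro P hP Q
    rw [GluedWitness.assemble_bracket, GluedWitness.family_bracket_clsInd_eq_zero cls i₀ P hP Q, map_zero]
  have hcommW : ∀ {X}, X ∈ 𝔰 → ∀ (P : ι → Matrix (Fin 2) (Fin 2) ℂ), X = assemble hint b P →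
      (∀ k, cls k = cls i₀ → P k = 0) → ρ X * E = E * ρ X ∧ ρ X * F' = F' * ρ X := by
    intro X hX P hXP hP
    constructor
    · have h := hρbr _ hX _ he𝔰
      rw [hXP, heOp, hcommM P hP (Matrix.single (0 : Fin 2) (1 : Fin 2) (1 : ℂ)), map_zero] at h
      rw [hEdef, hXP, heOp]
      exact (sub_eq_zero.1 h.symm)
    · have h := hρbr _ hX _ hf𝔰
      rw [hXP, hfOp, hcommM P hP (Matrix.single (1 : Fin 2) (0 : Fin 2) (1 : ℂ)), map_zero] at h
      rw [hFdef, hXP, hfOp]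
      exact (sub_eq_zero.1 h.symm)
  have hG01 : ∀ k, cls k = cls i₀ → G k 0 1 • (Matrix.single (0 : Fin 2) (1 : Fin 2) (1 : ℂ)) = 0 := fun k hk => by rw [hG0 k hk]; simp
  have hG10 : ∀ k, cls k = cls i₀ → G k 1 0 • (Matrix.single (1 : Fin 2) (0 : Fin 2) (1 : ℂ)) = 0 := fun k hk => by rw [hG0 k hk]; simp
  have hG00 : ∀ k, cls k = cls i₀ → G k 0 0 • (Matrix.single (0 : Fin 2) (1 : Fin 2) (1 : ℂ)) = 0 := fun k hk => by rw [hG0 k hk]; simp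
  have hB00 : ∀ k, cls k = cls i₀ → (if cls k = cls i₀ then (0 : Matrix (Fin 2) (Fin 2) ℂ) else (Matrix.single (1 : Fin 2) (0 : Fin 2) (1 : ℂ))) = 0 :=
    fun k hk => if_pos hk
  obtain ⟨hRpE, hRpF⟩ := hcommW hYp𝔰 _ hYp hG01
  obtain ⟨hRmE, hRmF⟩ := hcommW hYm𝔰 _ hYm hG10
  obtain ⟨hAE, hAF⟩ := hcommW hA₀𝔰 _ hA₀ hG00
  obtain ⟨hBE, hBF⟩ := hcommW hB₀𝔰 _ hB₀ hB00
  -- `ρ Y'` kills `Eu` and `F'Eu`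
  have hρYr : ρ Yr = ρ Yp + ρ Ym + (ρ A₀ * ρ B₀ - ρ B₀ * ρ A₀) := by
    rw [hYrdec, map_add, map_add, hρbr _ hA₀𝔰 _ hB₀𝔰]
  have hRpEz : ρ Yp * E = 0 := SymplecticWitness.mul_eq_zero_of_raise hRpΘ hΘE1
  have hAEz : ρ A₀ * E = 0 := SymplecticWitness.mul_eq_zero_of_raise hAΘ hΘE1
  have hRmFz : ρ Ym * F' = 0 := SymplecticWitness.mul_eq_zero_of_lower hRmΘ hΘF1
  have hBFz : ρ B₀ * F' = 0 := SymplecticWitness.mul_eq_zero_of_lower hBΘ hΘF1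
  have hRmu : ρ Ym u = 0 := GluedWitness.apply_eq_zero_of_lower hRmΘ hΘu
  have hBu : ρ B₀ u = 0 := GluedWitness.apply_eq_zero_of_lower hBΘ hΘu
  have hkill₁ : ρ Yr (E u) = 0 := by
    rw [hρYr, LinearMap.add_apply, LinearMap.add_apply, LinearMap.sub_apply, Module.End.mul_apply,
      Module.End.mul_apply, ← Module.End.mul_apply (f := ρ Yp), hRpEz, LinearMap.zero_apply, zero_add,
      ← Module.End.mul_apply (f := ρ Ym), hRmE, Module.End.mul_apply, hRmu, map_zero, zero_add,
      ← Module.End.mul_apply (f := ρ B₀) (g := E), hBE, Module.End.mul_apply, hBu, map_zero, map_zero, zero_sub,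
      ← Module.End.mul_apply (f := ρ A₀), hAEz, LinearMap.zero_apply, map_zero, neg_zero]
  have hkill₂ : ρ Yr (F' (E u)) = 0 := by
    rw [hρYr, LinearMap.add_apply, LinearMap.add_apply, LinearMap.sub_apply, Module.End.mul_apply,
      Module.End.mul_apply, ← Module.End.mul_apply (f := ρ Yp) (g := F'), hRpF, Module.End.mul_apply,
      ← Module.End.mul_apply (f := ρ Yp), hRpEz, LinearMap.zero_apply, map_zero, zero_add,
      ← Module.End.mul_apply (f := ρ Ym) (g := F'), hRmFz, LinearMap.zero_apply, zero_add,
      ← Module.End.mul_apply (f := ρ B₀) (g := F'), hBFz, LinearMap.zero_apply, map_zero, zero_sub,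
      ← Module.End.mul_apply (f := ρ A₀) (g := F'), hAF, Module.End.mul_apply,
      ← Module.End.mul_apply (f := ρ A₀) (g := E), hAEz, LinearMap.zero_apply, map_zero, map_zero, neg_zero]
  -- `ρ Y_c` on `Eu`, `F'Eu`
  have hYcEu : ρ Yc (E u) = N 0 0 • E u + N 1 0 • F' (E u) := by
    rw [hρYc, LinearMap.add_apply, LinearMap.add_apply, LinearMap.smul_apply, LinearMap.smul_apply,
      LinearMap.smul_apply, ← Module.End.mul_apply (f := E), hEE, LinearMap.zero_apply, smul_zero, zero_add,
      ← Module.End.mul_apply (f := Hw), hHwE, add_comm]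
  have hYcFEu : ρ Yc (F' (E u)) = N 0 1 • E u + N 1 1 • F' (E u) := by
    rw [hρYc, LinearMap.add_apply, LinearMap.add_apply, LinearMap.smul_apply, LinearMap.smul_apply,
      LinearMap.smul_apply, ← Module.End.mul_apply (f := E), ← Module.End.mul_apply (f := E * F'), hEFE,
      ← Module.End.mul_apply (f := F'), hFF, LinearMap.zero_apply, smul_zero, add_zero,
      ← Module.End.mul_apply (f := F') (g := E), ← Module.End.mul_apply (f := Hw), hHwFE, LinearMap.neg_apply,
      Module.End.mul_apply, hN11, neg_smul, smul_neg]
  -- conclusion on the block basis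
  refine (hint.collectedBasis b).ext fun ⟨k, c⟩ => ?_
  rw [DirectSum.IsInternal.collectedBasis_coe]
  change ρ Y (Fm (b k c)) = Fm (Y (b k c))
  rw [apply_basis_eq_sum hint b hYmaps k c, map_sum]
  simp_rw [map_smul, hFm]
  by_cases hk : k = i₀
  · subst hk
    rw [← hNdef]
    have hρY : ρ Y = ρ Yc + ρ Yr := by rw [hYsum, map_add]
    simp only [if_true, Fin.sum_univ_two, Fin.one_eq_zero_iff, OfNat.ofNat_ne_one, if_false]
    rw [hρY, LinearMap.add_apply]
    fin_cases c
    · simp only [Fin.zero_eta, if_true]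
      rw [hYcEu, hkill₁, add_zero]
    · simp only [Fin.mk_one, one_ne_zero, if_false]
      rw [hYcFEu, hkill₂, add_zero]
  · simp only [hk, if_false, smul_zero, Finset.sum_const_zero, map_zero]

end Witness

/-! ### §3 `𝔰𝔩₂` is simple; a non-zero ideal of the glued algebra all of whose members' blocks are non-zero contains every class operator, in particular the Hodge operator -/

section Ideal


/-- `ad e` of a trace-free matrix in coordinates: `[e, X] = X₁₀ h - 2 X₀₀ e`. [cite: Humphreys1972, §2.1 Example] -/
theorem GluedIdeal.sE_bracket_eq (X : Matrix (Fin 2) (Fin 2) ℂ) (hX : X.trace = 0) :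
    (Matrix.single (0 : Fin 2) (1 : Fin 2) (1 : ℂ)) * X - X * (Matrix.single (0 : Fin 2) (1 : Fin 2) (1 : ℂ)) = X 1 0 • (Matrix.diagonal ![(1 : ℂ), -1]) - ((2 : ℂ) * X 0 0) • (Matrix.single (0 : Fin 2) (1 : Fin 2) (1 : ℂ)) := by
  rw [Matrix.trace_fin_two] at hX
  have h11 : X 1 1 = -X 0 0 := by linear_combination hX
  ext a c
  fin_cases a <;> fin_cases c <;> simp [Matrix.mul_apply, Matrix.single, Matrix.diagonal, h11, two_mul, sub_eq_add_neg]

/-- `[e, h] = -2e`. [cite: Humphreys1972, §2.1 Example] -/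
theorem GluedIdeal.sE_bracket_sH : (Matrix.single (0 : Fin 2) (1 : Fin 2) (1 : ℂ)) * (Matrix.diagonal ![(1 : ℂ), -1]) - (Matrix.diagonal ![(1 : ℂ), -1]) * (Matrix.single (0 : Fin 2) (1 : Fin 2) (1 : ℂ)) = -((2 : ℂ) • (Matrix.single (0 : Fin 2) (1 : Fin 2) (1 : ℂ))) := by
  rw [← neg_sub, GluedWitness.sH_mul_sE_sub]

/-- `[f, e] = -h`. [cite: Humphreys1972, §2.1 Example] -/
theorem GluedIdeal.sF_bracket_sE : (Matrix.single (1 : Fin 2) (0 : Fin 2) (1 : ℂ)) * (Matrix.single (0 : Fin 2) (1 : Fin 2) (1 : ℂ)) - (Matrix.single (0 : Fin 2) (1 : Fin 2) (1 : ℂ)) * (Matrix.single (1 : Fin 2) (0 : Fin 2) (1 : ℂ)) = -(Matrix.diagonal ![(1 : ℂ), -1]) := by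
  rw [← neg_sub, GluedWitness.sE_mul_sF_sub]

/-- `[f, h] = 2f`. [cite: Humphreys1972, §2.1 Example] -/
theorem GluedIdeal.sF_bracket_sH : (Matrix.single (1 : Fin 2) (0 : Fin 2) (1 : ℂ)) * (Matrix.diagonal ![(1 : ℂ), -1]) - (Matrix.diagonal ![(1 : ℂ), -1]) * (Matrix.single (1 : Fin 2) (0 : Fin 2) (1 : ℂ)) = (2 : ℂ) • (Matrix.single (1 : Fin 2) (0 : Fin 2) (1 : ℂ)) := by
  rw [← neg_sub, GluedWitness.sH_mul_sF_sub, neg_neg]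

/-- **`𝔰𝔩₂(ℂ)` is simple** (Humphreys §2.1), in the form used here: a subspace of trace-free `2 × 2` matrices stable
under `[e, ·]` and `[f, ·]` and containing a non-zero element contains `e`, `f` and `h`. [cite: Humphreys1972, §2.1 Example] -/
theorem GluedIdeal.sl2_triple_mem (C : Submodule ℂ (Matrix (Fin 2) (Fin 2) ℂ)) (hC : ∀ Y ∈ C, Y.trace = 0)
    (hE : ∀ Y ∈ C, (Matrix.single (0 : Fin 2) (1 : Fin 2) (1 : ℂ)) * Y - Y * (Matrix.single (0 : Fin 2) (1 : Fin 2) (1 : ℂ)) ∈ C) (hF : ∀ Y ∈ C, (Matrix.single (1 : Fin 2) (0 : Fin 2) (1 : ℂ)) * Y - Y * (Matrix.single (1 : Fin 2) (0 : Fin 2) (1 : ℂ)) ∈ C) (hne : ∃ Y ∈ C, Y ≠ 0) :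
    (Matrix.single (0 : Fin 2) (1 : Fin 2) (1 : ℂ)) ∈ C ∧ (Matrix.single (1 : Fin 2) (0 : Fin 2) (1 : ℂ)) ∈ C ∧ (Matrix.diagonal ![(1 : ℂ), -1]) ∈ C := by
  obtain ⟨X, hXC, hX0⟩ := hne
  have htr := hC X hXC
  -- `e ∈ C`
  have heC : (Matrix.single (0 : Fin 2) (1 : Fin 2) (1 : ℂ)) ∈ C := by
    have h1 : X 1 0 • (Matrix.diagonal ![(1 : ℂ), -1]) - ((2 : ℂ) * X 0 0) • (Matrix.single (0 : Fin 2) (1 : Fin 2) (1 : ℂ)) ∈ C := by rw [← GluedIdeal.sE_bracket_eq X htr]; exact hE X hXC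
    have h2 : (Matrix.single (0 : Fin 2) (1 : Fin 2) (1 : ℂ)) * (X 1 0 • (Matrix.diagonal ![(1 : ℂ), -1]) - ((2 : ℂ) * X 0 0) • (Matrix.single (0 : Fin 2) (1 : Fin 2) (1 : ℂ))) - (X 1 0 • (Matrix.diagonal ![(1 : ℂ), -1]) - ((2 : ℂ) * X 0 0) • (Matrix.single (0 : Fin 2) (1 : Fin 2) (1 : ℂ))) * (Matrix.single (0 : Fin 2) (1 : Fin 2) (1 : ℂ)) ∈ C := hE _ h1
    have h2' : (Matrix.single (0 : Fin 2) (1 : Fin 2) (1 : ℂ)) * (X 1 0 • (Matrix.diagonal ![(1 : ℂ), -1]) - ((2 : ℂ) * X 0 0) • (Matrix.single (0 : Fin 2) (1 : Fin 2) (1 : ℂ))) - (X 1 0 • (Matrix.diagonal ![(1 : ℂ), -1]) - ((2 : ℂ) * X 0 0) • (Matrix.single (0 : Fin 2) (1 : Fin 2) (1 : ℂ))) * (Matrix.single (0 : Fin 2) (1 : Fin 2) (1 : ℂ)) =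
        -(((2 : ℂ) * X 1 0) • (Matrix.single (0 : Fin 2) (1 : Fin 2) (1 : ℂ))) := by
      rw [mul_sub, sub_mul, mul_smul_comm, mul_smul_comm, smul_mul_assoc, smul_mul_assoc, GluedWitness.sE_mul_sE,
        smul_zero, sub_zero, sub_zero, ← smul_sub, GluedIdeal.sE_bracket_sH, smul_neg, smul_smul, mul_comm (X 1 0)]
    rw [h2'] at h2
    by_cases hc : X 1 0 = 0
    · rw [hc, zero_smul, zero_sub] at h1
      by_cases hb : X 0 0 = 0
      · -- `X = X₀₁ e`
        have hXe : X = X 0 1 • (Matrix.single (0 : Fin 2) (1 : Fin 2) (1 : ℂ)) := by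
          conv_lhs => rw [GluedWitness.eq_sE_sF_sH_of_trace_eq_zero X htr]
          rw [hc, hb, zero_smul, zero_smul, add_zero, add_zero]
        have ha : X 0 1 ≠ 0 := by
          intro ha
          apply hX0
          rw [hXe, ha, zero_smul]
        have h3 : X 0 1 • (Matrix.single (0 : Fin 2) (1 : Fin 2) (1 : ℂ)) ∈ C := by rw [← hXe]; exact hXC
        have h := C.smul_mem (X 0 1)⁻¹ h3
        rwa [smul_smul, inv_mul_cancel₀ ha, one_smul] at h
      · have h := C.smul_mem (-((2 : ℂ) * X 0 0))⁻¹ h1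
        rwa [← neg_smul, smul_smul, inv_mul_cancel₀ (neg_ne_zero.2 (mul_ne_zero two_ne_zero hb)), one_smul] at h
    · have h := C.smul_mem (-((2 : ℂ) * X 1 0))⁻¹ h2
      rwa [← neg_smul, smul_smul, inv_mul_cancel₀ (neg_ne_zero.2 (mul_ne_zero two_ne_zero hc)), one_smul] at h
  -- `h ∈ C`, `f ∈ C`
  have hhC : (Matrix.diagonal ![(1 : ℂ), -1]) ∈ C := by
    have h := hF _ heC
    rw [GluedIdeal.sF_bracket_sE] at h
    have h' := C.neg_mem h
    rwa [neg_neg] at h'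
  have hfC : (Matrix.single (1 : Fin 2) (0 : Fin 2) (1 : ℂ)) ∈ C := by
    have h := hF _ hhC
    rw [GluedIdeal.sF_bracket_sH] at h
    have h' := C.smul_mem (2 : ℂ)⁻¹ h
    rwa [smul_smul, inv_mul_cancel₀ (two_ne_zero (α := ℂ)), one_smul] at h'
  exact ⟨heC, hfC, hhC⟩

variable {M : Type*} [AddCommGroup M] [Module ℂ M]
variable {ι : Type*} [Fintype ι] [DecidableEq ι] {T : ι → Submodule ℂ M}
  (hint : DirectSum.IsInternal T) (b : ∀ i, Module.Basis (Fin 2) ℂ (T i)) (cls : ι → ι)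

/-- Blocks of a bracket with a class operator: on the class, `[N, (blockMat Y)_k]`. [cite: Hazama1983, §3 (p. 305)] -/
theorem GluedIdeal.blockMat_clsInd_bracket (i₀ : ι) (N : Matrix (Fin 2) (Fin 2) ℂ) {Y : Module.End ℂ M}
    (hY : ∀ i, Set.MapsTo Y (T i) (T i)) (k : ι) (hk : cls k = cls i₀) :
    blockMat hint b (assemble hint b (fun j => if cls j = cls i₀ then N else 0) * Y -
        Y * assemble hint b (fun j => if cls j = cls i₀ then N else 0)) k =
      N * blockMat hint b Y k - blockMat hint b Y k * N := by
  have hA := assemble_mapsTo hint b (fun j => if cls j = cls i₀ then N else 0)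
  rw [map_sub, blockMat_mul hint b hA hY, blockMat_mul hint b hY hA, Pi.sub_apply, Pi.mul_apply, Pi.mul_apply,
    blockMat_assemble]
  simp only [hk, if_true]

/-- Blocks of a bracket with a class operator vanish off the class. [cite: Hazama1983, §3 (p. 305)] -/
theorem GluedIdeal.blockMat_clsInd_bracket_of_ne (i₀ : ι) (N : Matrix (Fin 2) (Fin 2) ℂ) {Y : Module.End ℂ M}
    (hY : ∀ i, Set.MapsTo Y (T i) (T i)) (k : ι) (hk : cls k ≠ cls i₀) :
    blockMat hint b (assemble hint b (fun j => if cls j = cls i₀ then N else 0) * Y -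
        Y * assemble hint b (fun j => if cls j = cls i₀ then N else 0)) k = 0 := by
  have hA := assemble_mapsTo hint b (fun j => if cls j = cls i₀ then N else 0)
  rw [map_sub, blockMat_mul hint b hA hY, blockMat_mul hint b hY hA, Pi.sub_apply, Pi.mul_apply, Pi.mul_apply,
    blockMat_assemble]
  simp only [hk, if_false, zero_mul, mul_zero, sub_zero]

/-- **A bracket of a class operator with a class-constant block-preserving operator is the class operator of the
bracket of blocks**: `[𝟙_c N, Y] = 𝟙_c [N, (blockMat Y)_{i₀}]`. [cite: Hazama1983, §3 (p. 306)] -/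
theorem GluedIdeal.clsInd_bracket_eq (i₀ : ι) (N : Matrix (Fin 2) (Fin 2) ℂ) {Y : Module.End ℂ M}
    (hY : ∀ i, Set.MapsTo Y (T i) (T i)) (hYcls : ∀ k k', cls k = cls k' → blockMat hint b Y k = blockMat hint b Y k') :
    assemble hint b (fun j => if cls j = cls i₀ then N else 0) * Y - Y * assemble hint b (fun j => if cls j = cls i₀ then N else 0) =
      assemble hint b (fun j => if cls j = cls i₀ then N * blockMat hint b Y i₀ - blockMat hint b Y i₀ * N else 0) := by
  have hA := assemble_mapsTo hint b (fun j => if cls j = cls i₀ then N else 0)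
  have hbr : ∀ i, Set.MapsTo (assemble hint b (fun j => if cls j = cls i₀ then N else 0) * Y -
      Y * assemble hint b (fun j => if cls j = cls i₀ then N else 0)) (T i) (T i) := by
    intro i x hx
    show (assemble hint b (fun j => if cls j = cls i₀ then N else 0) * Y -
      Y * assemble hint b (fun j => if cls j = cls i₀ then N else 0)) x ∈ T i
    rw [LinearMap.sub_apply, Module.End.mul_apply, Module.End.mul_apply]
    exact Submodule.sub_mem _ (hA i (hY i hx)) (hY i (hA i hx))
  refine eq_of_blockMat_eq hint b hbr
    (assemble_mapsTo hint b (fun j => if cls j = cls i₀ then N * blockMat hint b Y i₀ - blockMat hint b Y i₀ * N else 0)) ?_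
  rw [blockMat_assemble hint b (fun j => if cls j = cls i₀ then N * blockMat hint b Y i₀ - blockMat hint b Y i₀ * N else 0)]
  funext k
  by_cases hk : cls k = cls i₀
  · rw [GluedIdeal.blockMat_clsInd_bracket hint b cls i₀ N hY k hk, hYcls k i₀ hk]
    simp only [hk, if_true]
  · rw [GluedIdeal.blockMat_clsInd_bracket_of_ne hint b cls i₀ N hY k hk]
    simp only [hk, if_false]

/-- **A non-zero ideal of the glued algebra whose generator has all blocks non-zero contains every class
operator** (Moonen–Zarhin: `hg(X₂)` is `ℚ`-simple; here: `J ⊆ 𝔰` stable under brackets with the class operators,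
containing an element `r` with `(blockMat r)_k ≠ 0` for all `k` — by `𝔰𝔩₂`-simplicity class by class).
[cite: MoonenZarhin1999LowDim, §3 Lemma (3.4) and Remark (3.5)] [cite: Humphreys1972, §2.1 Example] [cite: Hazama1983, §3 (p. 306)] -/
theorem GluedIdeal.assemble_clsInd_mem (J : Submodule ℂ (Module.End ℂ M))
    (hJmaps : ∀ Y ∈ J, ∀ i, Set.MapsTo Y (T i) (T i)) (hJtr : ∀ Y ∈ J, ∀ k, (blockMat hint b Y k).trace = 0)
    (hJcls : ∀ Y ∈ J, ∀ k k', cls k = cls k' → blockMat hint b Y k = blockMat hint b Y k')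
    (hideal : ∀ (i₀ : ι) (N : Matrix (Fin 2) (Fin 2) ℂ), N.trace = 0 → ∀ Y ∈ J,
      assemble hint b (fun j => if cls j = cls i₀ then N else 0) * Y - Y * assemble hint b (fun j => if cls j = cls i₀ then N else 0) ∈ J)
    {r : Module.End ℂ M} (hrJ : r ∈ J) (hr : ∀ k, blockMat hint b r k ≠ 0)
    (i₀ : ι) (N : Matrix (Fin 2) (Fin 2) ℂ) (hN : N.trace = 0) :
    assemble hint b (fun j => if cls j = cls i₀ then N else 0) ∈ J := by
  classical
  -- the blocks of `J` at `i₀`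
  obtain ⟨pr, hpr⟩ : ∃ L : Module.End ℂ M →ₗ[ℂ] Matrix (Fin 2) (Fin 2) ℂ, ∀ Y, L Y = blockMat hint b Y i₀ :=
    ⟨(LinearMap.proj i₀).comp (blockMat hint b), fun Y => rfl⟩
  set C : Submodule ℂ (Matrix (Fin 2) (Fin 2) ℂ) := J.map pr with hCdef
  have hCmem : ∀ {Z}, Z ∈ C ↔ ∃ Y ∈ J, blockMat hint b Y i₀ = Z := by
    intro Z; rw [hCdef, Submodule.mem_map]; simp only [hpr]
  have hCtr : ∀ Z ∈ C, Z.trace = 0 := by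
    intro Z hZ
    obtain ⟨Y, hY, rfl⟩ := hCmem.1 hZ
    exact hJtr Y hY i₀
  have hCbr : ∀ (A : Matrix (Fin 2) (Fin 2) ℂ), A.trace = 0 → ∀ Z ∈ C, A * Z - Z * A ∈ C := by
    intro A hA Z hZ
    obtain ⟨Y, hY, rfl⟩ := hCmem.1 hZ
    refine hCmem.2 ⟨_, hideal i₀ A hA Y hY, ?_⟩
    exact GluedIdeal.blockMat_clsInd_bracket hint b cls i₀ A (hJmaps Y hY) i₀ rfl
  obtain ⟨heC, hfC, hhC⟩ := GluedIdeal.sl2_triple_mem C hCtr (hCbr (Matrix.single (0 : Fin 2) (1 : Fin 2) (1 : ℂ)) GluedWitness.trace_sE)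
    (hCbr (Matrix.single (1 : Fin 2) (0 : Fin 2) (1 : ℂ)) GluedWitness.trace_sF) ⟨_, hCmem.2 ⟨r, hrJ, rfl⟩, hr i₀⟩
  -- an element of `J` with block `h` at `i₀`; bracket with `e_c`, `f_c`
  obtain ⟨Yh, hYhJ, hYh⟩ := hCmem.1 hhC
  have he : assemble hint b (fun j => if cls j = cls i₀ then (Matrix.single (0 : Fin 2) (1 : Fin 2) (1 : ℂ)) else 0) ∈ J := by
    have h := hideal i₀ (Matrix.single (0 : Fin 2) (1 : Fin 2) (1 : ℂ)) GluedWitness.trace_sE Yh hYhJ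
    rw [GluedIdeal.clsInd_bracket_eq hint b cls i₀ (Matrix.single (0 : Fin 2) (1 : Fin 2) (1 : ℂ)) (hJmaps Yh hYhJ) (hJcls Yh hYhJ), hYh, GluedIdeal.sE_bracket_sH,
      ← GluedWitness.clsInd_neg, ← GluedWitness.clsInd_smul, map_neg, map_smul] at h
    have h' := J.smul_mem (-(2 : ℂ)⁻¹) h
    rwa [smul_neg, neg_smul, neg_neg, smul_smul, inv_mul_cancel₀ (two_ne_zero (α := ℂ)), one_smul] at h'
  have hf : assemble hint b (fun j => if cls j = cls i₀ then (Matrix.single (1 : Fin 2) (0 : Fin 2) (1 : ℂ)) else 0) ∈ J := by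
    have h := hideal i₀ (Matrix.single (1 : Fin 2) (0 : Fin 2) (1 : ℂ)) GluedWitness.trace_sF Yh hYhJ
    rw [GluedIdeal.clsInd_bracket_eq hint b cls i₀ (Matrix.single (1 : Fin 2) (0 : Fin 2) (1 : ℂ)) (hJmaps Yh hYhJ) (hJcls Yh hYhJ), hYh, GluedIdeal.sF_bracket_sH,
      ← GluedWitness.clsInd_smul, map_smul] at h
    have h' := J.smul_mem (2 : ℂ)⁻¹ h
    rwa [smul_smul, inv_mul_cancel₀ (two_ne_zero (α := ℂ)), one_smul] at h'
  have hh : assemble hint b (fun j => if cls j = cls i₀ then (Matrix.diagonal ![(1 : ℂ), -1]) else 0) ∈ J := by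
    have h := hideal i₀ (Matrix.single (0 : Fin 2) (1 : Fin 2) (1 : ℂ)) GluedWitness.trace_sE _ hf
    rwa [GluedWitness.clsInd_sE_bracket_clsInd_sF hint b cls i₀] at h
  -- every trace-free `N`
  have hfam : (fun j => if cls j = cls i₀ then N else 0) =
      N 0 1 • (fun k => if cls k = cls i₀ then (Matrix.single (0 : Fin 2) (1 : Fin 2) (1 : ℂ)) else 0) + N 1 0 • (fun k => if cls k = cls i₀ then (Matrix.single (1 : Fin 2) (0 : Fin 2) (1 : ℂ)) else 0) +
        N 0 0 • (fun k => if cls k = cls i₀ then (Matrix.diagonal ![(1 : ℂ), -1]) else 0) := by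
    rw [GluedWitness.clsInd_smul, GluedWitness.clsInd_smul, GluedWitness.clsInd_smul, GluedWitness.clsInd_add,
      GluedWitness.clsInd_add, ← GluedWitness.eq_sE_sF_sH_of_trace_eq_zero N hN]
  rw [hfam, map_add, map_add, map_smul, map_smul, map_smul]
  exact J.add_mem (J.add_mem (J.smul_mem _ he) (J.smul_mem _ hf)) (J.smul_mem _ hh)

/-- **Corollary: such an ideal contains the Hodge operator `⊕ diag(1,-1)`** (sum of the class operators `h_c` over
the classes of the idempotent class map). [cite: MoonenZarhin1999LowDim, §3 Lemma (3.4) and Remark (3.5)]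
[cite: Hazama1983, §3 (p. 306)] -/
theorem GluedIdeal.assemble_sH_mem (hcls : ∀ k, cls (cls k) = cls k) (J : Submodule ℂ (Module.End ℂ M))
    (hJmaps : ∀ Y ∈ J, ∀ i, Set.MapsTo Y (T i) (T i)) (hJtr : ∀ Y ∈ J, ∀ k, (blockMat hint b Y k).trace = 0)
    (hJcls : ∀ Y ∈ J, ∀ k k', cls k = cls k' → blockMat hint b Y k = blockMat hint b Y k')
    (hideal : ∀ (i₀ : ι) (N : Matrix (Fin 2) (Fin 2) ℂ), N.trace = 0 → ∀ Y ∈ J,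
      assemble hint b (fun j => if cls j = cls i₀ then N else 0) * Y - Y * assemble hint b (fun j => if cls j = cls i₀ then N else 0) ∈ J)
    {r : Module.End ℂ M} (hrJ : r ∈ J) (hr : ∀ k, blockMat hint b r k ≠ 0) :
    assemble hint b (fun _ => (Matrix.diagonal ![(1 : ℂ), -1])) ∈ J := by
  rw [GluedWitness.eq_sum_clsInd cls hcls (fun _ : ι => (Matrix.diagonal ![(1 : ℂ), -1])) (fun _ _ _ => rfl), map_sum]
  exact J.sum_mem fun c _ => GluedIdeal.assemble_clsInd_mem hint b cls J hJmaps hJtr hJcls hideal hrJ hr c (Matrix.diagonal ![(1 : ℂ), -1])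
    GluedWitness.trace_sH

/-- **The glued algebra is spanned by its class operators**: an operator with the three glued properties is the
sum over the classes of the class operators of its blocks. [cite: Hazama1983, §3 (p. 306)] -/
theorem GluedIdeal.mem_of_glued (hcls : ∀ k, cls (cls k) = cls k) (G : Submodule ℂ (Module.End ℂ M))
    (hG3 : ∀ (i₀ : ι) (N : Matrix (Fin 2) (Fin 2) ℂ), N.trace = 0 → assemble hint b (fun j => if cls j = cls i₀ then N else 0) ∈ G)
    {Y : Module.End ℂ M} (hYmaps : ∀ i, Set.MapsTo Y (T i) (T i)) (hYtr : ∀ k, (blockMat hint b Y k).trace = 0)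
    (hYcls : ∀ k k', cls k = cls k' → blockMat hint b Y k = blockMat hint b Y k') : Y ∈ G := by
  rw [← assemble_blockMat hint b hYmaps, GluedWitness.eq_sum_clsInd cls hcls (blockMat hint b Y) hYcls, map_sum]
  exact G.sum_mem fun c _ => hG3 c _ (hYtr c)

end Ideal

/-! ### §4 The Goursat step for a second factor with glued `𝔰𝔩₂`-blocks: `Hom = 0` excludes the graph -/

section Goursat


universe u

variable {U V₁ V₂ : Type u} [AddCommGroup U] [Module ℚ U] [AddCommGroup V₁] [Module ℚ V₁]
  [AddCommGroup V₂] [Module ℚ V₂] [Module.Finite ℚ U] [Module.Finite ℚ V₁] [Module.Finite ℚ V₂]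
  [HodgeTensorFacts.{u, u}] {n : ℤ}

set_option maxHeartbeats 800000 in
/-- **The Goursat step with a second factor whose admissible algebras are glued `𝔰𝔩₂`-blocks (Moonen–Zarhin Lemma
(3.4), Lie form).** Let `U = ι₁V₁ ⊕ ι₂V₂` and let `𝔞 ⊆ End_ℚ(U)` be a bracket-closed space of block-diagonal
operators with `ψ_i`-skew corners, the second corners commuting with `End_Hdg(V₂)`, whose complex span contains an
operator `Θ_U` inducing the Hodge operators `Θ₁`, `Θ₂` of the effective weight-one structures `H₁`, `H₂`. On
`V₂ ⊗ ℂ` let an internal decomposition into two-dimensional blocks `T_k` with Hodge-adapted bases `b₂ k` and an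
idempotent class map `cls` be given such that (GLUED) every ADMISSIBLE rational `𝔤₂` (bracket-closed, `ψ₂`-skew,
commuting with `End_Hdg(V₂)`, `Θ₂ ∈ (𝔤₂)_ℂ`) has `(𝔤₂)_ℂ = ⊕_{classes} 𝔰𝔩₂` glued along `cls` (trace-free blocks,
equal blocks along classes, all class operators present: the tree's `GluedBlocks.exists_glued_adapted_blockBasis`
for abelian varieties with a totally real self-commutant subfield of degree `dim`, or with a real splitting),
(BLOCKS) rational operators commuting with `End_Hdg(V₂)` preserve the blocks, and (QS) a non-zero rational
`ψ₂`-skew operator commuting with `End_Hdg(V₂)` is non-zero on every block («`hg(X₂)` is `ℚ`-simple»). If NO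
non-zero `ℚ`-linear `f : V₂ → V₁` intertwines `Θ₂` and `Θ₁` («`Hom(X₂, X₁) = 0`»), then `ι₁ c₁X π₁ ∈ 𝔞` for all
`X ∈ 𝔞` («`Hg(X₁ × X₂) = Hg(X₁) × Hg(X₂)`»). PROOF. If `K = 𝔞 ∩ ker c₁ ≠ 0`: `c₂(K)` is a non-zero ideal of
`𝔤₂ = c₂(𝔞)` containing a rational `r ≠ 0`, non-zero on every block by (QS); by `𝔰𝔩₂`-simplicity class by class
(`GluedIdeal.assemble_sH_mem`) `Θ₂ ∈ c₂(K)_ℂ`, so `c₂(K)` is admissible and by (GLUED) `c₂(K)_ℂ = (𝔤₂)_ℂ`; descent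
gives `c₂(𝔞) = c₂(K)`, whence `ι₂c₂Xπ₂ ∈ K ⊆ 𝔞`. THE GRAPH CASE `K = 0` is impossible: as in the tree's
`goursat_incl_corner_mem_of_hom_eq_zero_of_rigid` (complementary ideal `𝔤₃` of `𝔨₁ = c₁(𝔞 ∩ ker c₂)`,
`𝔞₃ = 𝔞 ∩ c₁⁻¹(𝔤₃)`, `c₂ : (𝔞₃)_ℂ ≅ 𝔰 = (𝔤₂)_ℂ`, `ρ = c₁ ∘ c₂⁻¹`), the glued witness
`GluedWitness.exists_equivariant_ne_zero` («`V_{X₂}` is the only irreducible length-1 `hg(X₂)`-module») gives a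
non-zero `ρ`-equivariant `F : V₂ ⊗ ℂ → V₁ ⊗ ℂ`, so `Z' = ι₁Fπ₂ ≠ 0` commutes with `(𝔞₃)_ℂ`, whereas every RATIONAL
`Z` commuting with `𝔞₃` has `π₁Zι₂ = 0` (equivariant, hence intertwining `Θ₂`, `Θ₁`:
`GluedWitness.theta_comp_eq_of_equivariant`, then (HOM)) — contradicting descent of commutants.
[cite: MoonenZarhin1999LowDim, §3 (3.1), Lemma (3.3), Lemma (3.4)] [cite: Hazama1989, Thm. (= Gordon 7.6.2)]
[cite: Deligne1982HodgeCycles, I §3 (proof of Prop. 3.4) and Prop. 3.6] -/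
theorem goursat_incl_corner_mem_of_hom_eq_zero_of_glued (hn : n = 1) (H₁ : HodgeStructure V₁ n)
    (H₂ : HodgeStructure V₂ n) (heff₁ : H₁.IsEffective) (heff₂ : H₂.IsEffective)
    {ι₁ : V₁ →ₗ[ℚ] U} {π₁ : U →ₗ[ℚ] V₁} {ι₂ : V₂ →ₗ[ℚ] U} {π₂ : U →ₗ[ℚ] V₂}
    (hπι₁ : π₁ ∘ₗ ι₁ = LinearMap.id) (hπι₂ : π₂ ∘ₗ ι₂ = LinearMap.id) (hπ₁ι₂ : π₁ ∘ₗ ι₂ = 0)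
    (hπ₂ι₁ : π₂ ∘ₗ ι₁ = 0) (hsum : ι₁ ∘ₗ π₁ + ι₂ ∘ₗ π₂ = LinearMap.id)
    (𝔞 : Submodule ℚ (Module.End ℚ U)) (hbr : ∀ X ∈ 𝔞, ∀ X' ∈ 𝔞, X * X' - X' * X ∈ 𝔞)
    (hP₁ : ∀ X ∈ 𝔞, X * (ι₁ ∘ₗ π₁) = (ι₁ ∘ₗ π₁) * X) (hP₂ : ∀ X ∈ 𝔞, X * (ι₂ ∘ₗ π₂) = (ι₂ ∘ₗ π₂) * X)
    (ψ₁ : H₁.Polarization) (ψ₂ : H₂.Polarization)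
    (hskew₁ : ∀ X ∈ 𝔞, ∀ v w, ψ₁.form ((π₁ ∘ₗ X ∘ₗ ι₁) v) w + ψ₁.form v ((π₁ ∘ₗ X ∘ₗ ι₁) w) = 0)
    (hskew₂ : ∀ X ∈ 𝔞, ∀ v w, ψ₂.form ((π₂ ∘ₗ X ∘ₗ ι₂) v) w + ψ₂.form v ((π₂ ∘ₗ X ∘ₗ ι₂) w) = 0)
    (hcomm₂ : ∀ X ∈ 𝔞, ∀ a : H₂.endAlg,
      (π₂ ∘ₗ X ∘ₗ ι₂) * (a : Module.End ℚ V₂) = (a : Module.End ℚ V₂) * (π₂ ∘ₗ X ∘ₗ ι₂))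
    {Θ₁ : Module.End ℂ (ℂ ⊗[ℚ] V₁)} (hΘ₁ : ∀ p, ∀ x ∈ H₁.piece p (n - p), Θ₁ x = ((2 * p - n : ℤ) : ℂ) • x)
    {Θ₂ : Module.End ℂ (ℂ ⊗[ℚ] V₂)} (hΘ₂ : ∀ p, ∀ x ∈ H₂.piece p (n - p), Θ₂ x = ((2 * p - n : ℤ) : ℂ) • x)
    {κ : Type*} [Fintype κ] [DecidableEq κ] [Nonempty κ] {T : κ → Submodule ℂ (ℂ ⊗[ℚ] V₂)}
    (hint : DirectSum.IsInternal T) (b₂ : ∀ k, Module.Basis (Fin 2) ℂ (T k))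
    (hb0 : ∀ k, (b₂ k 0 : ℂ ⊗[ℚ] V₂) ∈ H₂.piece 1 (n - 1)) (hb1 : ∀ k, (b₂ k 1 : ℂ ⊗[ℚ] V₂) ∈ H₂.piece 0 (n - 0))
    (cls : κ → κ) (hcls : ∀ k, cls (cls k) = cls k)
    (hTE : ∀ X : Module.End ℚ V₂, (∀ a : H₂.endAlg, X * (a : Module.End ℚ V₂) = (a : Module.End ℚ V₂) * X) →
      ∀ k, Set.MapsTo (X.baseChange ℂ) (T k) (T k))
    (hglued : ∀ 𝔤₂ : Submodule ℚ (Module.End ℚ V₂), (∀ X ∈ 𝔤₂, ∀ X' ∈ 𝔤₂, X * X' - X' * X ∈ 𝔤₂) →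
      Θ₂ ∈ spanC 𝔤₂ → (∀ X ∈ 𝔤₂, ∀ a : H₂.endAlg, X * (a : Module.End ℚ V₂) = (a : Module.End ℚ V₂) * X) →
      (∀ X ∈ 𝔤₂, ∀ v w, ψ₂.form (X v) w + ψ₂.form v (X w) = 0) →
      (∀ Y ∈ spanC 𝔤₂, ∀ k, (blockMat hint b₂ Y k).trace = 0) ∧
      (∀ Y ∈ spanC 𝔤₂, ∀ k k', cls k = cls k' → blockMat hint b₂ Y k = blockMat hint b₂ Y k') ∧
      (∀ (k₀ : κ) (N : Matrix (Fin 2) (Fin 2) ℂ), N.trace = 0 →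
        assemble hint b₂ (fun k => if cls k = cls k₀ then N else 0) ∈ spanC 𝔤₂))
    (hqs : ∀ X : Module.End ℚ V₂, (∀ a : H₂.endAlg, X * (a : Module.End ℚ V₂) = (a : Module.End ℚ V₂) * X) →
      (∀ v w, ψ₂.form (X v) w + ψ₂.form v (X w) = 0) → X ≠ 0 → ∀ k, ∃ x ∈ T k, X.baseChange ℂ x ≠ 0)
    {ΘU : Module.End ℂ (ℂ ⊗[ℚ] U)} (hΘU𝔞 : ΘU ∈ spanC 𝔞)
    (hΘUι₁ : ∀ x, ΘU (ι₁.baseChange ℂ x) = ι₁.baseChange ℂ (Θ₁ x))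
    (hΘUι₂ : ∀ x, ΘU (ι₂.baseChange ℂ x) = ι₂.baseChange ℂ (Θ₂ x))
    (hHom : ∀ f : V₂ →ₗ[ℚ] V₁, Θ₁ ∘ₗ f.baseChange ℂ = f.baseChange ℂ ∘ₗ Θ₂ → f = 0) :
    ∀ X ∈ 𝔞, ι₁ ∘ₗ (π₁ ∘ₗ X ∘ₗ ι₁) ∘ₗ π₁ ∈ 𝔞 := by
  classical
  have hsum' : ι₂ ∘ₗ π₂ + ι₁ ∘ₗ π₁ = LinearMap.id := by rw [add_comm]; exact hsum
  -- the corner maps as linear maps, rational and complex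
  obtain ⟨cL₁, hcL₁⟩ : ∃ L : Module.End ℚ U →ₗ[ℚ] Module.End ℚ V₁, ∀ X, L X = π₁ ∘ₗ X ∘ₗ ι₁ :=
    ⟨{ toFun := fun X => π₁ ∘ₗ X ∘ₗ ι₁
       map_add' := fun X X' => by rw [LinearMap.add_comp, LinearMap.comp_add]
       map_smul' := fun c X => by rw [LinearMap.smul_comp, LinearMap.comp_smul, RingHom.id_apply] },
      fun X => rfl⟩
  obtain ⟨cL₂, hcL₂⟩ : ∃ L : Module.End ℚ U →ₗ[ℚ] Module.End ℚ V₂, ∀ X, L X = π₂ ∘ₗ X ∘ₗ ι₂ :=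
    ⟨{ toFun := fun X => π₂ ∘ₗ X ∘ₗ ι₂
       map_add' := fun X X' => by rw [LinearMap.add_comp, LinearMap.comp_add]
       map_smul' := fun c X => by rw [LinearMap.smul_comp, LinearMap.comp_smul, RingHom.id_apply] },
      fun X => rfl⟩
  obtain ⟨LC₁, hLC₁⟩ : ∃ L : Module.End ℂ (ℂ ⊗[ℚ] U) →ₗ[ℂ] Module.End ℂ (ℂ ⊗[ℚ] V₁),
      ∀ T, L T = π₁.baseChange ℂ ∘ₗ T ∘ₗ ι₁.baseChange ℂ :=
    ⟨{ toFun := fun T => π₁.baseChange ℂ ∘ₗ T ∘ₗ ι₁.baseChange ℂ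
       map_add' := fun T T' => by rw [LinearMap.add_comp, LinearMap.comp_add]
       map_smul' := fun c T => by rw [LinearMap.smul_comp, LinearMap.comp_smul, RingHom.id_apply] },
      fun T => rfl⟩
  obtain ⟨LC₂, hLC₂⟩ : ∃ L : Module.End ℂ (ℂ ⊗[ℚ] U) →ₗ[ℂ] Module.End ℂ (ℂ ⊗[ℚ] V₂),
      ∀ T, L T = π₂.baseChange ℂ ∘ₗ T ∘ₗ ι₂.baseChange ℂ :=
    ⟨{ toFun := fun T => π₂.baseChange ℂ ∘ₗ T ∘ₗ ι₂.baseChange ℂ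
       map_add' := fun T T' => by rw [LinearMap.add_comp, LinearMap.comp_add]
       map_smul' := fun c T => by rw [LinearMap.smul_comp, LinearMap.comp_smul, RingHom.id_apply] },
      fun T => rfl⟩
  have hLC₁c : ∀ X : Module.End ℚ U, LC₁ (X.baseChange ℂ) = (cL₁ X).baseChange ℂ := fun X => by
    rw [hLC₁, hcL₁, LinearMap.baseChange_comp, LinearMap.baseChange_comp]
  have hLC₂c : ∀ X : Module.End ℚ U, LC₂ (X.baseChange ℂ) = (cL₂ X).baseChange ℂ := fun X => by
    rw [hLC₂, hcL₂, LinearMap.baseChange_comp, LinearMap.baseChange_comp]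
  -- corners of brackets
  have hc₁br : ∀ X ∈ 𝔞, ∀ X' ∈ 𝔞, π₁ ∘ₗ (X * X' - X' * X) ∘ₗ ι₁ =
      (π₁ ∘ₗ X ∘ₗ ι₁) * (π₁ ∘ₗ X' ∘ₗ ι₁) - (π₁ ∘ₗ X' ∘ₗ ι₁) * (π₁ ∘ₗ X ∘ₗ ι₁) := fun X hX X' hX' =>
    corner_bracket hπι₁ hπι₂ hπ₁ι₂ hsum (hP₁ X hX) (hP₂ X hX) (hP₁ X' hX') (hP₂ X' hX')
  have hc₂br : ∀ X ∈ 𝔞, ∀ X' ∈ 𝔞, π₂ ∘ₗ (X * X' - X' * X) ∘ₗ ι₂ =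
      (π₂ ∘ₗ X ∘ₗ ι₂) * (π₂ ∘ₗ X' ∘ₗ ι₂) - (π₂ ∘ₗ X' ∘ₗ ι₂) * (π₂ ∘ₗ X ∘ₗ ι₂) := fun X hX X' hX' =>
    corner_bracket hπι₂ hπι₁ hπ₂ι₁ hsum' (hP₂ X hX) (hP₁ X hX) (hP₂ X' hX') (hP₁ X' hX')
  -- the corner algebras `𝔤₁ = c₁(𝔞)`, `𝔤₂ = c₂(𝔞)`
  set 𝔤₁ : Submodule ℚ (Module.End ℚ V₁) := 𝔞.map cL₁ with h𝔤₁
  have h𝔤₁mem : ∀ {Y}, Y ∈ 𝔤₁ ↔ ∃ X ∈ 𝔞, π₁ ∘ₗ X ∘ₗ ι₁ = Y := by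
    intro Y
    rw [h𝔤₁, Submodule.mem_map]
    simp only [hcL₁]
  have hbr𝔤₁ : ∀ Y ∈ 𝔤₁, ∀ Y' ∈ 𝔤₁, Y * Y' - Y' * Y ∈ 𝔤₁ := by
    intro Y hY Y' hY'
    obtain ⟨X, hX, rfl⟩ := h𝔤₁mem.1 hY
    obtain ⟨X', hX', rfl⟩ := h𝔤₁mem.1 hY'
    exact h𝔤₁mem.2 ⟨_, hbr X hX X' hX', hc₁br X hX X' hX'⟩
  have hskew𝔤₁ : ∀ Y ∈ 𝔤₁, ∀ v w, ψ₁.form (Y v) w + ψ₁.form v (Y w) = 0 := by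
    intro Y hY v w
    obtain ⟨X, hX, rfl⟩ := h𝔤₁mem.1 hY
    exact hskew₁ X hX v w
  set 𝔤₂ : Submodule ℚ (Module.End ℚ V₂) := 𝔞.map cL₂ with h𝔤₂
  have h𝔤₂mem : ∀ {Y}, Y ∈ 𝔤₂ ↔ ∃ X ∈ 𝔞, π₂ ∘ₗ X ∘ₗ ι₂ = Y := by
    intro Y
    rw [h𝔤₂, Submodule.mem_map]
    simp only [hcL₂]
  have hbr𝔤₂ : ∀ Y ∈ 𝔤₂, ∀ Y' ∈ 𝔤₂, Y * Y' - Y' * Y ∈ 𝔤₂ := by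
    intro Y hY Y' hY'
    obtain ⟨X, hX, rfl⟩ := h𝔤₂mem.1 hY
    obtain ⟨X', hX', rfl⟩ := h𝔤₂mem.1 hY'
    exact h𝔤₂mem.2 ⟨_, hbr X hX X' hX', hc₂br X hX X' hX'⟩
  have hskew𝔤₂ : ∀ Y ∈ 𝔤₂, ∀ v w, ψ₂.form (Y v) w + ψ₂.form v (Y w) = 0 := by
    intro Y hY v w
    obtain ⟨X, hX, rfl⟩ := h𝔤₂mem.1 hY
    exact hskew₂ X hX v w
  have hcomm𝔤₂ : ∀ Y ∈ 𝔤₂, ∀ a : H₂.endAlg, Y * (a : Module.End ℚ V₂) = (a : Module.End ℚ V₂) * Y := by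
    intro Y hY a
    obtain ⟨X, hX, rfl⟩ := h𝔤₂mem.1 hY
    exact hcomm₂ X hX a
  -- `Θ_i = c_i(Θ_U) ∈ (𝔤_i)_ℂ`
  have hΘ₁eq : LC₁ ΘU = Θ₁ := by
    rw [hLC₁]
    apply LinearMap.ext
    intro x
    rw [LinearMap.comp_apply, LinearMap.comp_apply, hΘUι₁, proj_incl_baseChange hπι₁]
  have hΘ₂eq : LC₂ ΘU = Θ₂ := by
    rw [hLC₂]
    apply LinearMap.ext
    intro x
    rw [LinearMap.comp_apply, LinearMap.comp_apply, hΘUι₂, proj_incl_baseChange hπι₂]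
  have hΘ𝔤₁ : Θ₁ ∈ spanC 𝔤₁ := by rw [← hΘ₁eq]; exact map_mem_spanC_map cL₁ LC₁ hLC₁c 𝔞 hΘU𝔞
  have hΘ𝔤₂ : Θ₂ ∈ spanC 𝔤₂ := by rw [← hΘ₂eq]; exact map_mem_spanC_map cL₂ LC₂ hLC₂c 𝔞 hΘU𝔞
  -- `Θ² = 1` on the blocks and on `U`; `Θ₂` is the assembled `h`
  have hΘΘ₁ : ∀ v, Θ₁ (Θ₁ v) = v := theta_theta_apply H₁ hn heff₁ hΘ₁
  have hΘΘ₂ : ∀ v, Θ₂ (Θ₂ v) = v := theta_theta_apply H₂ hn heff₂ hΘ₂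
  have hΘ₂A : Θ₂ = assemble hint b₂ (fun _ => (Matrix.diagonal ![(1 : ℂ), -1])) := by
    refine GluedWitness.theta_eq_assemble hint b₂ (fun k => ?_) (fun k => ?_)
    · have h := hΘ₂ 1 _ (hb0 k)
      rw [h, hn]; norm_num
    · have h := hΘ₂ 0 _ (hb1 k)
      rw [h, hn]; norm_num
  -- the glued algebra `𝔰 ⊆ End(V₂ ⊗ ℂ)`
  let 𝔰C : Submodule ℂ (Module.End ℂ (ℂ ⊗[ℚ] V₂)) :=
    { carrier := {Y | (∀ i, Set.MapsTo Y (T i) (T i)) ∧ (∀ k, (blockMat hint b₂ Y k).trace = 0) ∧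
        ∀ k k', cls k = cls k' → blockMat hint b₂ Y k = blockMat hint b₂ Y k'}
      zero_mem' := ⟨fun i x _ => by rw [LinearMap.zero_apply]; exact Submodule.zero_mem _,
        fun k => by rw [map_zero, Pi.zero_apply, Matrix.trace_zero],
        fun k k' _ => by rw [map_zero, Pi.zero_apply, Pi.zero_apply]⟩
      add_mem' := by
        intro Y Y' hY hY'
        exact ⟨fun i x hx => by rw [LinearMap.add_apply]; exact Submodule.add_mem _ (hY.1 i hx) (hY'.1 i hx),
          fun k => by rw [map_add, Pi.add_apply, Matrix.trace_add, hY.2.1 k, hY'.2.1 k, add_zero],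
          fun k k' h => by rw [map_add, Pi.add_apply, Pi.add_apply, hY.2.2 k k' h, hY'.2.2 k k' h]⟩
      smul_mem' := by
        intro c Y hY
        exact ⟨fun i x hx => by rw [LinearMap.smul_apply]; exact Submodule.smul_mem _ c (hY.1 i hx),
          fun k => by rw [map_smul, Pi.smul_apply, Matrix.trace_smul, hY.2.1 k, smul_zero],
          fun k k' h => by rw [map_smul, Pi.smul_apply, Pi.smul_apply, hY.2.2 k k' h]⟩ }
  have h𝔰C : ∀ Y, Y ∈ 𝔰C ↔ (∀ i, Set.MapsTo Y (T i) (T i)) ∧ (∀ k, (blockMat hint b₂ Y k).trace = 0) ∧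
      (∀ k k', cls k = cls k' → blockMat hint b₂ Y k = blockMat hint b₂ Y k') := fun Y => Iff.rfl
  -- an admissible algebra has complex span `𝔰`
  have hadm : ∀ 𝔤 : Submodule ℚ (Module.End ℚ V₂), (∀ X ∈ 𝔤, ∀ X' ∈ 𝔤, X * X' - X' * X ∈ 𝔤) →
      Θ₂ ∈ spanC 𝔤 → (∀ X ∈ 𝔤, ∀ a : H₂.endAlg, X * (a : Module.End ℚ V₂) = (a : Module.End ℚ V₂) * X) →
      (∀ X ∈ 𝔤, ∀ v w, ψ₂.form (X v) w + ψ₂.form v (X w) = 0) →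
      (∀ Y, Y ∈ spanC 𝔤 → Y ∈ 𝔰C) ∧ (∀ Y, Y ∈ 𝔰C → Y ∈ spanC 𝔤) := by
    intro 𝔤 hbr𝔤 hΘ𝔤 hcomm𝔤 hskew𝔤
    obtain ⟨hG1, hG2, hG3⟩ := hglued 𝔤 hbr𝔤 hΘ𝔤 hcomm𝔤 hskew𝔤
    refine ⟨fun Y hY => (h𝔰C Y).2 ⟨fun i => mapsTo_of_mem_spanC (fun X hX => hTE X (hcomm𝔤 X hX) i) hY,
      hG1 Y hY, hG2 Y hY⟩, fun Y hY => ?_⟩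
    obtain ⟨hYm, hYt, hYc⟩ := (h𝔰C Y).1 hY
    exact GluedIdeal.mem_of_glued hint b₂ cls hcls (spanC 𝔤) hG3 hYm hYt hYc
  obtain ⟨hsub₂, hfull₂⟩ := hadm 𝔤₂ hbr𝔤₂ hΘ𝔤₂ hcomm𝔤₂ hskew𝔤₂
  -- block calculus for elements of `𝔞_ℂ`
  have hPC₁ : ∀ T ∈ spanC 𝔞, T * (ι₁.baseChange ℂ ∘ₗ π₁.baseChange ℂ) = (ι₁.baseChange ℂ ∘ₗ π₁.baseChange ℂ) * T := by
    intro T hT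
    have h := mul_baseChange_eq_of_mem_spanC hP₁ hT
    rwa [LinearMap.baseChange_comp] at h
  have hPC₂ : ∀ T ∈ spanC 𝔞, T * (ι₂.baseChange ℂ ∘ₗ π₂.baseChange ℂ) = (ι₂.baseChange ℂ ∘ₗ π₂.baseChange ℂ) * T := by
    intro T hT
    have h := mul_baseChange_eq_of_mem_spanC hP₂ hT
    rwa [LinearMap.baseChange_comp] at h
  have happlyι₁ : ∀ T ∈ spanC 𝔞, ∀ v, T (ι₁.baseChange ℂ v) = ι₁.baseChange ℂ (LC₁ T v) := by
    intro T hT v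
    have h := congrArg (fun S : Module.End ℂ (ℂ ⊗[ℚ] U) => S (ι₁.baseChange ℂ v)) (hPC₁ T hT)
    simp only [Module.End.mul_apply, LinearMap.comp_apply, proj_incl_baseChange hπι₁] at h
    rw [hLC₁, LinearMap.comp_apply, LinearMap.comp_apply]
    exact h
  have happlyι₂ : ∀ T ∈ spanC 𝔞, ∀ v, T (ι₂.baseChange ℂ v) = ι₂.baseChange ℂ (LC₂ T v) := by
    intro T hT v
    have h := congrArg (fun S : Module.End ℂ (ℂ ⊗[ℚ] U) => S (ι₂.baseChange ℂ v)) (hPC₂ T hT)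
    simp only [Module.End.mul_apply, LinearMap.comp_apply, proj_incl_baseChange hπι₂] at h
    rw [hLC₂, LinearMap.comp_apply, LinearMap.comp_apply]
    exact h
  have hprojT₁ : ∀ T ∈ spanC 𝔞, ∀ y, π₁.baseChange ℂ (T y) = LC₁ T (π₁.baseChange ℂ y) := by
    intro T hT y
    conv_lhs => rw [← incl_proj_add_baseChange hsum y]
    rw [map_add, happlyι₁ T hT, happlyι₂ T hT, map_add, proj_incl_baseChange hπι₁,
      proj_incl_baseChange_eq_zero hπ₁ι₂, add_zero]
  have hprojT₂ : ∀ T ∈ spanC 𝔞, ∀ y, π₂.baseChange ℂ (T y) = LC₂ T (π₂.baseChange ℂ y) := by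
    intro T hT y
    conv_lhs => rw [← incl_proj_add_baseChange hsum y]
    rw [map_add, happlyι₁ T hT, happlyι₂ T hT, map_add, proj_incl_baseChange_eq_zero hπ₂ι₁,
      proj_incl_baseChange hπι₂, zero_add]
  have hLC₁mul : ∀ T T' : Module.End ℂ (ℂ ⊗[ℚ] U), T' ∈ spanC 𝔞 → LC₁ (T * T') = LC₁ T * LC₁ T' := by
    intro T T' hT'
    rw [hLC₁, hLC₁, hLC₁]
    exact cornerC_mul hπι₁ (hPC₁ T' hT')
  have hLC₂mul : ∀ T T' : Module.End ℂ (ℂ ⊗[ℚ] U), T' ∈ spanC 𝔞 → LC₂ (T * T') = LC₂ T * LC₂ T' := by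
    intro T T' hT'
    rw [hLC₂, hLC₂, hLC₂]
    exact cornerC_mul hπι₂ (hPC₂ T' hT')
  -- the kernel `K = 𝔞 ∩ ker c₁`
  set K : Submodule ℚ (Module.End ℚ U) := 𝔞 ⊓ LinearMap.ker cL₁ with hK
  have hKmem : ∀ {X}, X ∈ K ↔ X ∈ 𝔞 ∧ π₁ ∘ₗ X ∘ₗ ι₁ = 0 := by
    intro X
    rw [hK, Submodule.mem_inf, LinearMap.mem_ker, hcL₁]
  have hKideal : ∀ X' ∈ 𝔞, ∀ X ∈ K, X' * X - X * X' ∈ K := by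
    intro X' hX' X hX
    obtain ⟨hX𝔞, hc₁X⟩ := hKmem.1 hX
    refine hKmem.2 ⟨hbr X' hX' X hX𝔞, ?_⟩
    rw [hc₁br X' hX' X hX𝔞, hc₁X, mul_zero, zero_mul, sub_zero]
  -- `K ≠ 0`: the graph case is excluded by `Hom = 0`
  have hK0 : K ≠ ⊥ := by
    intro hKbot
    have hinj : ∀ X ∈ 𝔞, cL₁ X = 0 → X = 0 := fun X hX h0 => by
      have hXK : X ∈ K := hKmem.2 ⟨hX, by rw [← hcL₁]; exact h0⟩
      rw [hKbot] at hXK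
      exact (Submodule.mem_bot ℚ).1 hXK
    have hinjC : ∀ T ∈ spanC 𝔞, LC₁ T = 0 → T = 0 := fun T hT hT0 =>
      eq_zero_of_map_eq_zero_of_mem_spanC cL₁ LC₁ hLC₁c 𝔞 hinj hT hT0
    -- `𝔞₀ = 𝔞 ∩ ker c₂` and the ideal `𝔨₁ = c₁(𝔞₀)` of `𝔤₁`
    set 𝔞₀ : Submodule ℚ (Module.End ℚ U) := 𝔞 ⊓ LinearMap.ker cL₂ with h𝔞₀
    have h𝔞₀mem : ∀ {X}, X ∈ 𝔞₀ ↔ X ∈ 𝔞 ∧ π₂ ∘ₗ X ∘ₗ ι₂ = 0 := by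
      intro X
      rw [h𝔞₀, Submodule.mem_inf, LinearMap.mem_ker, hcL₂]
    have h𝔞₀ideal : ∀ X' ∈ 𝔞, ∀ X ∈ 𝔞₀, X' * X - X * X' ∈ 𝔞₀ := by
      intro X' hX' X hX
      obtain ⟨hX𝔞, hc₂X⟩ := h𝔞₀mem.1 hX
      refine h𝔞₀mem.2 ⟨hbr X' hX' X hX𝔞, ?_⟩
      rw [hc₂br X' hX' X hX𝔞, hc₂X, mul_zero, zero_mul, sub_zero]
    set 𝔨₁ : Submodule ℚ (Module.End ℚ V₁) := 𝔞₀.map cL₁ with h𝔨₁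
    have h𝔨₁mem : ∀ {Y}, Y ∈ 𝔨₁ ↔ ∃ X ∈ 𝔞₀, π₁ ∘ₗ X ∘ₗ ι₁ = Y := by
      intro Y
      rw [h𝔨₁, Submodule.mem_map]
      simp only [hcL₁]
    have h𝔨₁le : 𝔨₁ ≤ 𝔤₁ := Submodule.map_mono inf_le_left
    have h𝔨₁ideal : ∀ Y ∈ 𝔤₁, ∀ Y' ∈ 𝔨₁, Y * Y' - Y' * Y ∈ 𝔨₁ := by
      intro Y hY Y' hY'
      obtain ⟨X, hX, rfl⟩ := h𝔤₁mem.1 hY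
      obtain ⟨X', hX', rfl⟩ := h𝔨₁mem.1 hY'
      exact h𝔨₁mem.2 ⟨_, h𝔞₀ideal X hX X' hX', hc₁br X hX X' (h𝔞₀mem.1 hX').1⟩
    -- the complementary ideal `𝔤₃` and `𝔞₃ = 𝔞 ∩ c₁⁻¹(𝔤₃)`
    obtain ⟨𝔤₃, -, h𝔤₃ideal, h𝔨𝔤₃inf, h𝔨𝔤₃sup⟩ :=
      exists_ideal_compl H₁ hn heff₁ ψ₁ 𝔤₁ hbr𝔤₁ hΘ₁ hΘ𝔤₁ hskew𝔤₁ h𝔨₁le h𝔨₁ideal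
    set 𝔞₃ : Submodule ℚ (Module.End ℚ U) := 𝔞 ⊓ 𝔤₃.comap cL₁ with h𝔞₃
    have h𝔞₃mem : ∀ {X}, X ∈ 𝔞₃ ↔ X ∈ 𝔞 ∧ π₁ ∘ₗ X ∘ₗ ι₁ ∈ 𝔤₃ := by
      intro X
      rw [h𝔞₃, Submodule.mem_inf, Submodule.mem_comap, hcL₁]
    have h𝔞₃le : 𝔞₃ ≤ 𝔞 := inf_le_left
    have h𝔞₃leC : spanC 𝔞₃ ≤ spanC 𝔞 := spanC_mono h𝔞₃le
    have h𝔞₃ideal : ∀ X' ∈ 𝔞, ∀ X ∈ 𝔞₃, X' * X - X * X' ∈ 𝔞₃ := by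
      intro X' hX' X hX
      obtain ⟨hX𝔞, hc₁X⟩ := h𝔞₃mem.1 hX
      refine h𝔞₃mem.2 ⟨hbr X' hX' X hX𝔞, ?_⟩
      rw [hc₁br X' hX' X hX𝔞]
      exact h𝔤₃ideal _ (h𝔤₁mem.2 ⟨X', hX', rfl⟩) _ hc₁X
    have hbr𝔞₃ : ∀ X ∈ 𝔞₃, ∀ X' ∈ 𝔞₃, X * X' - X' * X ∈ 𝔞₃ := fun X hX X' hX' =>
      h𝔞₃ideal X (h𝔞₃le hX) X' hX'
    -- `c₂` is injective on `𝔞₃` and on `(𝔞₃)_ℂ`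
    have h𝔞₃inj : ∀ X ∈ 𝔞₃, cL₂ X = 0 → X = 0 := by
      intro X hX h0
      obtain ⟨hX𝔞, hc₁X⟩ := h𝔞₃mem.1 hX
      have hX0 : X ∈ 𝔞₀ := h𝔞₀mem.2 ⟨hX𝔞, by rw [← hcL₂]; exact h0⟩
      have hzero : π₁ ∘ₗ X ∘ₗ ι₁ ∈ 𝔨₁ ⊓ 𝔤₃ := Submodule.mem_inf.2 ⟨h𝔨₁mem.2 ⟨X, hX0, rfl⟩, hc₁X⟩
      rw [h𝔨𝔤₃inf, Submodule.mem_bot] at hzero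
      exact hinj X hX𝔞 (by rw [hcL₁]; exact hzero)
    have h𝔞₃injC : ∀ T ∈ spanC 𝔞₃, LC₂ T = 0 → T = 0 := fun T hT hT0 =>
      eq_zero_of_map_eq_zero_of_mem_spanC cL₂ LC₂ hLC₂c 𝔞₃ h𝔞₃inj hT hT0
    -- `𝔞 ⊆ 𝔞₀ + 𝔞₃`, so `c₂(𝔞) ⊆ c₂(𝔞₃)`, and `c₂(𝔞₃)` is admissible
    have h𝔞le : 𝔞 ≤ 𝔞₀ ⊔ 𝔞₃ := by
      intro X hX
      have hc₁ : π₁ ∘ₗ X ∘ₗ ι₁ ∈ 𝔨₁ ⊔ 𝔤₃ := by rw [h𝔨𝔤₃sup]; exact h𝔤₁mem.2 ⟨X, hX, rfl⟩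
      obtain ⟨k, hk, g, hg, hkg⟩ := Submodule.mem_sup.1 hc₁
      obtain ⟨X₀, hX₀, rfl⟩ := h𝔨₁mem.1 hk
      have hX₀𝔞 : X₀ ∈ 𝔞 := (h𝔞₀mem.1 hX₀).1
      refine Submodule.mem_sup.2 ⟨X₀, hX₀, X - X₀, h𝔞₃mem.2 ⟨Submodule.sub_mem _ hX hX₀𝔞, ?_⟩, by abel⟩
      have e : π₁ ∘ₗ (X - X₀) ∘ₗ ι₁ = g := by
        rw [LinearMap.sub_comp, LinearMap.comp_sub, ← hkg]
        abel
      rw [e]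
      exact hg
    set 𝔤₂₃ : Submodule ℚ (Module.End ℚ V₂) := 𝔞₃.map cL₂ with h𝔤₂₃
    have h𝔤₂₃mem : ∀ {Y}, Y ∈ 𝔤₂₃ ↔ ∃ X ∈ 𝔞₃, π₂ ∘ₗ X ∘ₗ ι₂ = Y := by
      intro Y
      rw [h𝔤₂₃, Submodule.mem_map]
      simp only [hcL₂]
    have h𝔤₂le : 𝔤₂ ≤ 𝔤₂₃ := by
      intro Y hY
      obtain ⟨X, hX, rfl⟩ := h𝔤₂mem.1 hY
      obtain ⟨X₀, hX₀, X₃, hX₃, rfl⟩ := Submodule.mem_sup.1 (h𝔞le hX)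
      refine h𝔤₂₃mem.2 ⟨X₃, hX₃, ?_⟩
      rw [LinearMap.add_comp, LinearMap.comp_add, (h𝔞₀mem.1 hX₀).2, zero_add]
    have h𝔤₂₃le : 𝔤₂₃ ≤ 𝔤₂ := Submodule.map_mono h𝔞₃le
    have hbr𝔤₂₃ : ∀ Y ∈ 𝔤₂₃, ∀ Y' ∈ 𝔤₂₃, Y * Y' - Y' * Y ∈ 𝔤₂₃ := by
      intro Y hY Y' hY'
      obtain ⟨X, hX, rfl⟩ := h𝔤₂₃mem.1 hY
      obtain ⟨X', hX', rfl⟩ := h𝔤₂₃mem.1 hY'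
      exact h𝔤₂₃mem.2 ⟨_, hbr𝔞₃ X hX X' hX', hc₂br X (h𝔞₃le hX) X' (h𝔞₃le hX')⟩
    have hskew𝔤₂₃ : ∀ Y ∈ 𝔤₂₃, ∀ v w, ψ₂.form (Y v) w + ψ₂.form v (Y w) = 0 :=
      fun Y hY => hskew𝔤₂ Y (h𝔤₂₃le hY)
    have hcomm𝔤₂₃ : ∀ Y ∈ 𝔤₂₃, ∀ a : H₂.endAlg, Y * (a : Module.End ℚ V₂) = (a : Module.End ℚ V₂) * Y :=
      fun Y hY => hcomm𝔤₂ Y (h𝔤₂₃le hY)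
    have hΘ𝔤₂₃ : Θ₂ ∈ spanC 𝔤₂₃ := spanC_mono h𝔤₂le hΘ𝔤₂
    obtain ⟨hsub₃, hfull₃⟩ := hadm 𝔤₂₃ hbr𝔤₂₃ hΘ𝔤₂₃ hcomm𝔤₂₃ hskew𝔤₂₃
    have hmemC₃ : ∀ T ∈ spanC 𝔞₃, LC₂ T ∈ 𝔰C := fun T hT =>
      hsub₃ _ (map_mem_spanC_map cL₂ LC₂ hLC₂c 𝔞₃ hT)
    -- `ρ = c₁ ∘ (c₂|_{(𝔞₃)_ℂ})⁻¹ : 𝔰 → End(V₁ ⊗ ℂ)` (`c₂` is a bijection `(𝔞₃)_ℂ ≅ 𝔰`)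
    set f₃ : ↥(spanC 𝔞₃) →ₗ[ℂ] ↥𝔰C :=
      (LC₂.domRestrict (spanC 𝔞₃)).codRestrict 𝔰C (fun T => hmemC₃ T.1 T.2) with hf₃
    have hf₃apply : ∀ T : ↥(spanC 𝔞₃), (f₃ T : Module.End ℂ (ℂ ⊗[ℚ] V₂)) = LC₂ T := fun T => rfl
    have hf₃inj : Function.Injective f₃ := by
      intro T T' h
      have h' : LC₂ (T : Module.End ℂ (ℂ ⊗[ℚ] U)) = LC₂ (T' : Module.End ℂ (ℂ ⊗[ℚ] U)) := by
        rw [← hf₃apply, ← hf₃apply, h]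
      apply Subtype.ext
      have h0 := h𝔞₃injC _ (Submodule.sub_mem _ T.2 T'.2) (by rw [map_sub, h', sub_self])
      exact sub_eq_zero.1 h0
    have hf₃surj : Function.Surjective f₃ := by
      rintro ⟨Y, hY⟩
      obtain ⟨T, hT, hTY⟩ := exists_mem_spanC_map_eq cL₂ LC₂ hLC₂c 𝔞₃ (hfull₃ Y hY)
      exact ⟨⟨T, hT⟩, Subtype.ext (by rw [hf₃apply]; exact hTY)⟩
    obtain ⟨eqv, heqv⟩ : ∃ e : ↥(spanC 𝔞₃) ≃ₗ[ℂ] ↥𝔰C, ∀ T, (e T : Module.End ℂ (ℂ ⊗[ℚ] V₂)) = LC₂ T :=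
      ⟨LinearEquiv.ofBijective f₃ ⟨hf₃inj, hf₃surj⟩, fun T => rfl⟩
    obtain ⟨K𝔰, hK𝔰⟩ := Submodule.exists_isCompl 𝔰C
    obtain ⟨ρ, hρdef⟩ : ∃ ρ : Module.End ℂ (ℂ ⊗[ℚ] V₂) →ₗ[ℂ] Module.End ℂ (ℂ ⊗[ℚ] V₁),
        ∀ Y, ρ Y = LC₁ ((eqv.symm (Submodule.projectionOnto 𝔰C K𝔰 hK𝔰 Y) : ↥(spanC 𝔞₃)) :
          Module.End ℂ (ℂ ⊗[ℚ] U)) :=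
      ⟨LC₁ ∘ₗ (spanC 𝔞₃).subtype ∘ₗ eqv.symm.toLinearMap ∘ₗ Submodule.projectionOnto 𝔰C K𝔰 hK𝔰,
        fun Y => rfl⟩
    have hρ : ∀ Y ∈ 𝔰C, ∃ T ∈ spanC 𝔞₃, LC₂ T = Y ∧ ρ Y = LC₁ T := by
      intro Y hY
      refine ⟨(eqv.symm ⟨Y, hY⟩ : ↥(spanC 𝔞₃)), (eqv.symm ⟨Y, hY⟩).2, ?_, ?_⟩
      · rw [← heqv, LinearEquiv.apply_symm_apply]
      · rw [hρdef, Submodule.projectionOnto_apply_of_mem_left hK𝔰 hY]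
    have hρT : ∀ T ∈ spanC 𝔞₃, ρ (LC₂ T) = LC₁ T := by
      intro T hT
      obtain ⟨T', hT', hT'Y, hρY⟩ := hρ (LC₂ T) (hmemC₃ T hT)
      have hTT' : T' = T := by
        have h := h𝔞₃injC (T' - T) (Submodule.sub_mem _ hT' hT) (by rw [map_sub, hT'Y, sub_self])
        exact sub_eq_zero.1 h
      rw [hρY, hTT']
    -- `ρ` preserves brackets, transports `ad Θ₂` to `ad Θ₁`, and is injective on `𝔰`
    have hρbr : ∀ Y ∈ 𝔰C, ∀ Y' ∈ 𝔰C, ρ (Y * Y' - Y' * Y) = ρ Y * ρ Y' - ρ Y' * ρ Y := by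
      intro Y hY Y' hY'
      obtain ⟨T, hT, rfl, hρY⟩ := hρ Y hY
      obtain ⟨T', hT', rfl, hρY'⟩ := hρ Y' hY'
      rw [hρY, hρY', ← hLC₂mul T T' (h𝔞₃leC hT'), ← hLC₂mul T' T (h𝔞₃leC hT), ← map_sub,
        hρT _ (bracket_mem_spanC_of_forall hbr𝔞₃ hT hT'), map_sub, hLC₁mul T T' (h𝔞₃leC hT'),
        hLC₁mul T' T (h𝔞₃leC hT)]
    have hρΘ : ∀ Y ∈ 𝔰C, ρ (Θ₂ * Y - Y * Θ₂) = Θ₁ * ρ Y - ρ Y * Θ₁ := by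
      intro Y hY
      obtain ⟨T, hT, rfl, hρY⟩ := hρ Y hY
      rw [hρY, ← hΘ₂eq, ← hLC₂mul ΘU T (h𝔞₃leC hT), ← hLC₂mul T ΘU hΘU𝔞, ← map_sub,
        hρT _ (bracket_mem_spanC_of_forall h𝔞₃ideal hΘU𝔞 hT), map_sub, hLC₁mul ΘU T (h𝔞₃leC hT),
        hLC₁mul T ΘU hΘU𝔞, hΘ₁eq]
    have hρΘ' : ∀ Y ∈ 𝔰C, ρ (assemble hint b₂ (fun _ => (Matrix.diagonal ![(1 : ℂ), -1])) * Y - Y * assemble hint b₂ (fun _ => (Matrix.diagonal ![(1 : ℂ), -1]))) =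
        Θ₁ * ρ Y - ρ Y * Θ₁ := fun Y hY => by rw [← hΘ₂A]; exact hρΘ Y hY
    have hρinj : ∀ Y ∈ 𝔰C, ρ Y = 0 → Y = 0 := by
      intro Y hY h0
      obtain ⟨T, hT, rfl, hρY⟩ := hρ Y hY
      rw [hρY] at h0
      rw [hinjC T (h𝔞₃leC hT) h0, map_zero]
    -- THE WITNESS: a non-zero `ρ`-equivariant `F : V₂ ⊗ ℂ → V₁ ⊗ ℂ`
    obtain ⟨Fm, hFmne, hFmeq⟩ := GluedWitness.exists_equivariant_ne_zero hint b₂ cls (Classical.arbitrary κ) 𝔰C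
      h𝔰C hΘΘ₁ ρ hρbr hρΘ' hρinj
    obtain ⟨Z', hZ'⟩ : ∃ Z' : Module.End ℂ (ℂ ⊗[ℚ] U), Z' = ι₁.baseChange ℂ ∘ₗ Fm ∘ₗ π₂.baseChange ℂ :=
      ⟨_, rfl⟩
    have hcommZ' : ∀ T ∈ spanC 𝔞, LC₁ T ∘ₗ Fm = Fm ∘ₗ LC₂ T → T * Z' = Z' * T := by
      intro T hT hTF
      apply LinearMap.ext
      intro y
      rw [Module.End.mul_apply, Module.End.mul_apply, hZ', LinearMap.comp_apply, LinearMap.comp_apply,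
        happlyι₁ T hT, LinearMap.comp_apply, LinearMap.comp_apply, hprojT₂ T hT, ← LinearMap.comp_apply (f := LC₁ T),
        hTF, LinearMap.comp_apply]
    have hcomm₃ : ∀ T ∈ spanC 𝔞₃, T * Z' = Z' * T := by
      intro T hT
      refine hcommZ' T (h𝔞₃leC hT) ?_
      have h := hFmeq (LC₂ T) (hmemC₃ T hT)
      rw [hρT T hT] at h
      exact h
    -- descent: `Z'` lies in the complex span of the RATIONAL operators commuting with `𝔞₃` ...
    have hZ'span := mem_span_baseChange_of_forall_commute (𝔞₃ : Set (Module.End ℚ U)) (Y := Z')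
      (fun X hX => (hcomm₃ _ (baseChange_mem_spanC hX)).symm)
    -- ... whose `(1,2)`-blocks vanish by `Hom = 0`: they are `ρ`-equivariant, hence intertwine `Θ₂`, `Θ₁`
    have hblock : ∀ Z : Module.End ℚ U, (∀ X ∈ (𝔞₃ : Set (Module.End ℚ U)), Z * X = X * Z) →
        π₁ ∘ₗ Z ∘ₗ ι₂ = 0 := by
      intro Z hZ
      have hZC : ∀ T ∈ spanC 𝔞₃, T * Z.baseChange ℂ = Z.baseChange ℂ * T := fun T hT =>
        (commute_of_mem_spanC (𝔤 := 𝔞₃) (T := Z.baseChange ℂ) (fun X hX => by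
          rw [← LinearMap.baseChange_mul, hZ X hX, LinearMap.baseChange_mul]) hT).symm
      have hfT : ∀ T ∈ spanC 𝔞₃, ∀ x, (π₁ ∘ₗ Z ∘ₗ ι₂).baseChange ℂ (LC₂ T x) =
          LC₁ T ((π₁ ∘ₗ Z ∘ₗ ι₂).baseChange ℂ x) := by
        intro T hT x
        have hT𝔞 : T ∈ spanC 𝔞 := h𝔞₃leC hT
        rw [LinearMap.baseChange_comp, LinearMap.baseChange_comp, LinearMap.comp_apply, LinearMap.comp_apply,
          LinearMap.comp_apply, LinearMap.comp_apply, ← happlyι₂ T hT𝔞, ← Module.End.mul_apply (f := Z.baseChange ℂ),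
          ← hZC T hT, Module.End.mul_apply, hprojT₁ T hT𝔞]
      refine hHom _ ?_
      rw [hΘ₂A]
      refine GluedWitness.theta_comp_eq_of_equivariant hint b₂ cls 𝔰C h𝔰C hΘΘ₁ ρ hρΘ' _ fun Y hY => ?_
      obtain ⟨T, hT, rfl, hρY⟩ := hρ Y hY
      rw [hρY]
      exact LinearMap.ext fun x => (hfT T hT x).symm
    -- hence the `(1,2)`-block `Fm` of `Z'` vanishes: contradiction
    obtain ⟨Φ, hΦ⟩ : ∃ L : Module.End ℂ (ℂ ⊗[ℚ] U) →ₗ[ℂ] (ℂ ⊗[ℚ] V₂ →ₗ[ℂ] ℂ ⊗[ℚ] V₁),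
        ∀ T, L T = π₁.baseChange ℂ ∘ₗ T ∘ₗ ι₂.baseChange ℂ :=
      ⟨{ toFun := fun T => π₁.baseChange ℂ ∘ₗ T ∘ₗ ι₂.baseChange ℂ
         map_add' := fun T T' => by rw [LinearMap.add_comp, LinearMap.comp_add]
         map_smul' := fun c T => by rw [LinearMap.smul_comp, LinearMap.comp_smul, RingHom.id_apply] },
        fun T => rfl⟩
    have hΦspan : ∀ T ∈ Submodule.span ℂ ((fun Z : Module.End ℚ U => Z.baseChange ℂ) ''
        {Z | ∀ X ∈ (𝔞₃ : Set (Module.End ℚ U)), Z * X = X * Z}), Φ T = 0 := by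
      intro T hT
      induction hT using Submodule.span_induction with
      | mem T' hT' =>
        obtain ⟨Z, hZ, rfl⟩ := hT'
        rw [hΦ, ← LinearMap.baseChange_comp, ← LinearMap.baseChange_comp, hblock Z hZ, LinearMap.baseChange_zero]
      | zero => rw [map_zero]
      | add T' T'' _ _ h' h'' => rw [map_add, h', h'', add_zero]
      | smul c T' _ h' => rw [map_smul, h', smul_zero]
    have hFm0' : Fm = 0 := by
      have h := hΦspan Z' hZ'span
      rw [hΦ, hZ'] at h
      have h' : π₁.baseChange ℂ ∘ₗ (ι₁.baseChange ℂ ∘ₗ Fm ∘ₗ π₂.baseChange ℂ) ∘ₗ ι₂.baseChange ℂ = Fm := by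
        apply LinearMap.ext
        intro x
        simp only [LinearMap.comp_apply, proj_incl_baseChange hπι₁, proj_incl_baseChange hπι₂]
      rw [h'] at h
      exact h
    exact hFmne hFm0'
  -- `K ≠ 0`: the ideal `c₂(K)` of `𝔤₂`
  obtain ⟨X₀, hX₀K, hX₀ne⟩ := (Submodule.ne_bot_iff K).1 hK0
  set 𝔤K : Submodule ℚ (Module.End ℚ V₂) := K.map cL₂ with h𝔤K
  have h𝔤Kmem : ∀ {Y}, Y ∈ 𝔤K ↔ ∃ X ∈ K, π₂ ∘ₗ X ∘ₗ ι₂ = Y := by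
    intro Y
    rw [h𝔤K, Submodule.mem_map]
    simp only [hcL₂]
  have h𝔤Kle : 𝔤K ≤ 𝔤₂ := Submodule.map_mono inf_le_left
  have hideal𝔤K : ∀ Y ∈ 𝔤₂, ∀ Y' ∈ 𝔤K, Y * Y' - Y' * Y ∈ 𝔤K := by
    intro Y hY Y' hY'
    obtain ⟨X, hX, rfl⟩ := h𝔤₂mem.1 hY
    obtain ⟨X', hX', rfl⟩ := h𝔤Kmem.1 hY'
    exact h𝔤Kmem.2 ⟨_, hKideal X hX X' hX', hc₂br X hX X' (hKmem.1 hX').1⟩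
  have hskew𝔤K : ∀ Y ∈ 𝔤K, ∀ v w, ψ₂.form (Y v) w + ψ₂.form v (Y w) = 0 :=
    fun Y hY => hskew𝔤₂ Y (h𝔤Kle hY)
  have hcomm𝔤K : ∀ Y ∈ 𝔤K, ∀ a : H₂.endAlg, Y * (a : Module.End ℚ V₂) = (a : Module.End ℚ V₂) * Y :=
    fun Y hY => hcomm𝔤₂ Y (h𝔤Kle hY)
  have hbr𝔤K : ∀ Y ∈ 𝔤K, ∀ Y' ∈ 𝔤K, Y * Y' - Y' * Y ∈ 𝔤K := fun Y hY Y' hY' =>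
    hideal𝔤K Y (h𝔤Kle hY) Y' hY'
  -- a rational `r = c₂X₀ ≠ 0` in `c₂(K)`, non-zero on every block by (QS)
  have hc₂X₀ : π₂ ∘ₗ X₀ ∘ₗ ι₂ ≠ 0 := by
    intro h0
    obtain ⟨hX₀𝔞, hc₁X₀⟩ := hKmem.1 hX₀K
    apply hX₀ne
    rw [eq_incl_corner_add hπι₁ hπι₂ hsum (hP₁ X₀ hX₀𝔞) (hP₂ X₀ hX₀𝔞), hc₁X₀, h0]
    simp only [LinearMap.zero_comp, LinearMap.comp_zero, add_zero]
  have hr𝔤K : π₂ ∘ₗ X₀ ∘ₗ ι₂ ∈ 𝔤K := h𝔤Kmem.2 ⟨X₀, hX₀K, rfl⟩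
  have hrmaps : ∀ k, Set.MapsTo ((π₂ ∘ₗ X₀ ∘ₗ ι₂).baseChange ℂ) (T k) (T k) :=
    hTE _ (hcomm𝔤₂ _ (h𝔤Kle hr𝔤K))
  have hrblk : ∀ k, blockMat hint b₂ ((π₂ ∘ₗ X₀ ∘ₗ ι₂).baseChange ℂ) k ≠ 0 := by
    intro k hk
    obtain ⟨x, hxT, hx⟩ := hqs _ (hcomm𝔤₂ _ (h𝔤Kle hr𝔤K)) (hskew𝔤₂ _ (h𝔤Kle hr𝔤K)) hc₂X₀ k
    exact hx (GluedBlocks.apply_eq_zero_of_blockMat_eq_zero hint b₂ hrmaps hk hxT)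
  -- `Θ₂ ∈ c₂(K)_ℂ` by `𝔰𝔩₂`-simplicity class by class
  have hJle : spanC 𝔤K ≤ spanC 𝔤₂ := spanC_mono h𝔤Kle
  have hJmaps : ∀ Y ∈ spanC 𝔤K, ∀ i, Set.MapsTo Y (T i) (T i) := fun Y hY => ((h𝔰C Y).1 (hsub₂ Y (hJle hY))).1
  have hJtr : ∀ Y ∈ spanC 𝔤K, ∀ k, (blockMat hint b₂ Y k).trace = 0 := fun Y hY => ((h𝔰C Y).1 (hsub₂ Y (hJle hY))).2.1
  have hJcls : ∀ Y ∈ spanC 𝔤K, ∀ k k', cls k = cls k' → blockMat hint b₂ Y k = blockMat hint b₂ Y k' :=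
    fun Y hY => ((h𝔰C Y).1 (hsub₂ Y (hJle hY))).2.2
  have hJideal : ∀ (k₀ : κ) (N : Matrix (Fin 2) (Fin 2) ℂ), N.trace = 0 → ∀ Y ∈ spanC 𝔤K,
      assemble hint b₂ (fun j => if cls j = cls k₀ then N else 0) * Y -
        Y * assemble hint b₂ (fun j => if cls j = cls k₀ then N else 0) ∈ spanC 𝔤K := by
    intro k₀ N hN Y hY
    have hA : assemble hint b₂ (fun j => if cls j = cls k₀ then N else 0) ∈ spanC 𝔤₂ :=
      hfull₂ _ (GluedWitness.assemble_clsInd_mem hint b₂ cls 𝔰C h𝔰C k₀ N hN)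
    exact bracket_mem_spanC_of_forall hideal𝔤K hA hY
  have hΘK : Θ₂ ∈ spanC 𝔤K := by
    rw [hΘ₂A]
    exact GluedIdeal.assemble_sH_mem hint b₂ cls hcls (spanC 𝔤K) hJmaps hJtr hJcls hJideal
      (baseChange_mem_spanC hr𝔤K) hrblk
  -- (GLUED) for `c₂(K)`: its complex span is `𝔰`; descent: `c₂(𝔞) = c₂(K)`
  obtain ⟨-, hfullK⟩ := hadm 𝔤K hbr𝔤K hΘK hcomm𝔤K hskew𝔤K
  have hconcl₂ : ∀ X ∈ 𝔞, ι₂ ∘ₗ (π₂ ∘ₗ X ∘ₗ ι₂) ∘ₗ π₂ ∈ 𝔞 := by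
    intro X hX
    have hmemC : (π₂ ∘ₗ X ∘ₗ ι₂).baseChange ℂ ∈ spanC 𝔤K :=
      hfullK _ (hsub₂ _ (baseChange_mem_spanC (h𝔤₂mem.2 ⟨X, hX, rfl⟩)))
    obtain ⟨X', hX'K, hX'eq⟩ := h𝔤Kmem.1 (mem_of_baseChange_mem_spanC 𝔤K hmemC)
    obtain ⟨hX'𝔞, hc₁X'⟩ := hKmem.1 hX'K
    have hdec := eq_incl_corner_add hπι₁ hπι₂ hsum (hP₁ X' hX'𝔞) (hP₂ X' hX'𝔞)
    rw [hc₁X', hX'eq] at hdec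
    simp only [LinearMap.zero_comp, LinearMap.comp_zero, zero_add] at hdec
    rw [← hdec]
    exact hX'𝔞
  intro X hX
  have hdec := eq_incl_corner_add hπι₁ hπι₂ hsum (hP₁ X hX) (hP₂ X hX)
  have heq : ι₁ ∘ₗ (π₁ ∘ₗ X ∘ₗ ι₁) ∘ₗ π₁ = X - ι₂ ∘ₗ (π₂ ∘ₗ X ∘ₗ ι₂) ∘ₗ π₂ :=
    eq_sub_of_add_eq hdec.symm
  rw [heq]
  exact Submodule.sub_mem _ hX (hconcl₂ X hX)

end Goursat

/-! ### §5 The theorems: `ι₁ Θ₁ π₁` kills every rational tensor killed by `Θ_U` -/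

section Main

universe u

variable {U V₁ V₂ : Type u} [AddCommGroup U] [Module ℚ U] [AddCommGroup V₁] [Module ℚ V₁]
  [AddCommGroup V₂] [Module ℚ V₂] [Module.Finite ℚ U] [Module.Finite ℚ V₁] [Module.Finite ℚ V₂]
  [HodgeTensorFacts.{u, u}] {n : ℤ}
variable {M d m : ℕ}

omit [Module.Finite ℚ U] [Module.Finite ℚ V₁] [Module.Finite ℚ V₂] [HodgeTensorFacts.{u, u}] in
/-- Complexification of a sum of bilinear forms, evaluated (a copy of the private lemma of
`HodgeThetaAnnihilatorTimesRigidSymplectic`). [folklore] -/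
private theorem baseChange_add_apply_glued (B B' : LinearMap.BilinForm ℚ U) (x y : ℂ ⊗[ℚ] U) :
    LinearMap.BilinForm.baseChange ℂ (B + B') x y =
      LinearMap.BilinForm.baseChange ℂ B x y + LinearMap.BilinForm.baseChange ℂ B' x y := by
  induction x using TensorProduct.induction_on with
  | zero => simp
  | tmul c v =>
    induction y using TensorProduct.induction_on with
    | zero => simp
    | tmul d w =>
      simp only [LinearMap.BilinForm.baseChange_tmul, LinearMap.add_apply, add_smul]
    | add y y' hy hy' => rw [map_add, map_add, map_add, hy, hy']; abel
  | add x x' hx hx' =>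
    rw [map_add, LinearMap.add_apply, map_add, map_add, LinearMap.add_apply, LinearMap.add_apply, hx, hx']
    abel

set_option maxHeartbeats 400000 in
/-- **The core (Moonen–Zarhin Lemma (3.4) for a second factor with glued `𝔰𝔩₂`-blocks, Lie form, word
model).** For the annihilator algebra `𝔞 = annLie φ eQ aF q` of a rational tensor `q` on `U = ι₁V₁ ⊕ ι₂V₂`
killed by `Θ_U` (`φ = ψ₁(π₁·,π₁·) + ψ₂(π₂·,π₂·)`; `aF` = the Hodge endomorphisms `ι₁ a π₁` (`a ∈ End_Hdg(V₁)`),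
`ι₂ a π₂` (`a ∈ End_Hdg(V₂)`) and the two projectors), with `V₂ ⊗ ℂ` carrying glued two-dimensional blocks
`(T, b₂, cls)` adapted to `H₂` such that (GLUED), (BLOCKS), (QS) of `goursat_incl_corner_mem_of_hom_eq_zero_of_glued`
hold, and `Hom_Hdg(V₂, V₁) = 0`: `ι₁ c₁X π₁ ∈ 𝔞` for all `X ∈ 𝔞`, and `Θ_U ∈ 𝔞_ℂ`
(«either `Hg(X) = Hg(X₁) × Hg(X₂)` or `Hom(X₂, X₁) ≠ 0`»).
[cite: MoonenZarhin1999LowDim, §3 (3.1) and Lemma (3.4)] [cite: Deligne1982HodgeCycles, I §3 (proof of Prop. 3.4)] -/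
theorem incl_corner_mem_annLie_of_times_gluedBlocks (hn : n = 1) (HU : HodgeStructure U n)
    (H₁ : HodgeStructure V₁ n) (H₂ : HodgeStructure V₂ n) (heff₁ : H₁.IsEffective) (heff₂ : H₂.IsEffective)
    {ι₁ : V₁ →ₗ[ℚ] U} {π₁ : U →ₗ[ℚ] V₁} {ι₂ : V₂ →ₗ[ℚ] U} {π₂ : U →ₗ[ℚ] V₂}
    (hπι₁ : π₁ ∘ₗ ι₁ = LinearMap.id) (hπι₂ : π₂ ∘ₗ ι₂ = LinearMap.id) (hπ₁ι₂ : π₁ ∘ₗ ι₂ = 0)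
    (hπ₂ι₁ : π₂ ∘ₗ ι₁ = 0) (hsum : ι₁ ∘ₗ π₁ + ι₂ ∘ₗ π₂ = LinearMap.id)
    (hι₁F : ∀ p, ∀ x ∈ H₁.piece p (n - p), ι₁.baseChange ℂ x ∈ HU.piece p (n - p))
    (hι₂F : ∀ p, ∀ x ∈ H₂.piece p (n - p), ι₂.baseChange ℂ x ∈ HU.piece p (n - p))
    (ψ₁ : H₁.Polarization) (ψ₂ : H₂.Polarization)
    {Θ₁ : Module.End ℂ (ℂ ⊗[ℚ] V₁)} (hΘ₁ : ∀ p, ∀ x ∈ H₁.piece p (n - p), Θ₁ x = ((2 * p - n : ℤ) : ℂ) • x)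
    {Θ₂ : Module.End ℂ (ℂ ⊗[ℚ] V₂)} (hΘ₂ : ∀ p, ∀ x ∈ H₂.piece p (n - p), Θ₂ x = ((2 * p - n : ℤ) : ℂ) • x)
    {κ : Type*} [Fintype κ] [DecidableEq κ] [Nonempty κ] {T : κ → Submodule ℂ (ℂ ⊗[ℚ] V₂)}
    (hint : DirectSum.IsInternal T) (b₂ : ∀ k, Module.Basis (Fin 2) ℂ (T k))
    (hb0 : ∀ k, (b₂ k 0 : ℂ ⊗[ℚ] V₂) ∈ H₂.piece 1 (n - 1)) (hb1 : ∀ k, (b₂ k 1 : ℂ ⊗[ℚ] V₂) ∈ H₂.piece 0 (n - 0))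
    (cls : κ → κ) (hcls : ∀ k, cls (cls k) = cls k)
    (hTE : ∀ X : Module.End ℚ V₂, (∀ a : H₂.endAlg, X * (a : Module.End ℚ V₂) = (a : Module.End ℚ V₂) * X) →
      ∀ k, Set.MapsTo (X.baseChange ℂ) (T k) (T k))
    (hglued : ∀ 𝔤₂ : Submodule ℚ (Module.End ℚ V₂), (∀ X ∈ 𝔤₂, ∀ X' ∈ 𝔤₂, X * X' - X' * X ∈ 𝔤₂) →
      Θ₂ ∈ spanC 𝔤₂ → (∀ X ∈ 𝔤₂, ∀ a : H₂.endAlg, X * (a : Module.End ℚ V₂) = (a : Module.End ℚ V₂) * X) →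
      (∀ X ∈ 𝔤₂, ∀ v w, ψ₂.form (X v) w + ψ₂.form v (X w) = 0) →
      (∀ Y ∈ spanC 𝔤₂, ∀ k, (blockMat hint b₂ Y k).trace = 0) ∧
      (∀ Y ∈ spanC 𝔤₂, ∀ k k', cls k = cls k' → blockMat hint b₂ Y k = blockMat hint b₂ Y k') ∧
      (∀ (k₀ : κ) (N : Matrix (Fin 2) (Fin 2) ℂ), N.trace = 0 →
        assemble hint b₂ (fun k => if cls k = cls k₀ then N else 0) ∈ spanC 𝔤₂))
    (hqs : ∀ X : Module.End ℚ V₂, (∀ a : H₂.endAlg, X * (a : Module.End ℚ V₂) = (a : Module.End ℚ V₂) * X) →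
      (∀ v w, ψ₂.form (X v) w + ψ₂.form v (X w) = 0) → X ≠ 0 → ∀ k, ∃ x ∈ T k, X.baseChange ℂ x ≠ 0)
    (hHom : ∀ f : V₂ →ₗ[ℚ] V₁,
      (∀ p, ∀ x ∈ H₂.piece p (n - p), f.baseChange ℂ x ∈ H₁.piece p (n - p)) → f = 0)
    (eQ : Module.Basis (Fin M) ℚ U) (q : (Fin d → Fin m × Fin M) → ℚ)
    {ΘU : Module.End ℂ (ℂ ⊗[ℚ] U)} (hΘU : ∀ p, ∀ x ∈ HU.piece p (n - p), ΘU x = ((2 * p - n : ℤ) : ℂ) • x)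
    (hΘq : ∀ u : Fin d → Fin m, wordDerAt ℂ (fun _ : Fin d =>
      LinearMap.toMatrix (Algebra.TensorProduct.basis ℂ eQ) (Algebra.TensorProduct.basis ℂ eQ) ΘU)
      (wordSlice (fun w => algebraMap ℚ ℂ (q w)) u) = 0) :
    (∀ X ∈ annLie (ψ₁.form.compl₁₂ π₁ π₁ + ψ₂.form.compl₁₂ π₂ π₂) eQ
        (Sum.elim (Sum.elim (fun a : H₁.endAlg => ι₁ ∘ₗ (a : Module.End ℚ V₁) ∘ₗ π₁)
            (fun a : H₂.endAlg => ι₂ ∘ₗ (a : Module.End ℚ V₂) ∘ₗ π₂))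
          (Sum.elim (fun _ : Unit => ι₁ ∘ₗ π₁) (fun _ : Unit => ι₂ ∘ₗ π₂))) q,
      ι₁ ∘ₗ (π₁ ∘ₗ X ∘ₗ ι₁) ∘ₗ π₁ ∈ annLie (ψ₁.form.compl₁₂ π₁ π₁ + ψ₂.form.compl₁₂ π₂ π₂) eQ
        (Sum.elim (Sum.elim (fun a : H₁.endAlg => ι₁ ∘ₗ (a : Module.End ℚ V₁) ∘ₗ π₁)
            (fun a : H₂.endAlg => ι₂ ∘ₗ (a : Module.End ℚ V₂) ∘ₗ π₂))
          (Sum.elim (fun _ : Unit => ι₁ ∘ₗ π₁) (fun _ : Unit => ι₂ ∘ₗ π₂))) q) ∧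
    ΘU ∈ spanC (annLie (ψ₁.form.compl₁₂ π₁ π₁ + ψ₂.form.compl₁₂ π₂ π₂) eQ
        (Sum.elim (Sum.elim (fun a : H₁.endAlg => ι₁ ∘ₗ (a : Module.End ℚ V₁) ∘ₗ π₁)
            (fun a : H₂.endAlg => ι₂ ∘ₗ (a : Module.End ℚ V₂) ∘ₗ π₂))
          (Sum.elim (fun _ : Unit => ι₁ ∘ₗ π₁) (fun _ : Unit => ι₂ ∘ₗ π₂))) q) := by
  classical
  have hΘ₁C : Θ₁ ∈ H₁.hodgeLieC := H₁.mem_hodgeLieC_of_forall_piece hΘ₁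
  have hΘ₂C : Θ₂ ∈ H₂.hodgeLieC := H₂.mem_hodgeLieC_of_forall_piece hΘ₂
  have hsum' : ι₂ ∘ₗ π₂ + ι₁ ∘ₗ π₁ = LinearMap.id := by rw [add_comm]; exact hsum
  have e11 : ∀ v, π₁ (ι₁ v) = v := fun v => by
    rw [← LinearMap.comp_apply (f := π₁), hπι₁, LinearMap.id_apply]
  have e22 : ∀ w, π₂ (ι₂ w) = w := fun w => by
    rw [← LinearMap.comp_apply (f := π₂), hπι₂, LinearMap.id_apply]
  have e12 : ∀ w, π₁ (ι₂ w) = 0 := fun w => by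
    rw [← LinearMap.comp_apply (f := π₁), hπ₁ι₂, LinearMap.zero_apply]
  have e21 : ∀ v, π₂ (ι₁ v) = 0 := fun v => by
    rw [← LinearMap.comp_apply (f := π₂), hπ₂ι₁, LinearMap.zero_apply]
  -- `Θ` through the presentation
  have hΘι₁ := theta_incl_eq HU H₁ hι₁F hΘU hΘ₁
  have hΘι₂ := theta_incl_eq HU H₂ hι₂F hΘU hΘ₂
  have hΘπ₁ := proj_theta_eq HU H₁ H₂ hπι₁ hπ₁ι₂ hsum hι₁F hι₂F hΘU hΘ₁ hΘ₂
  have hΘπ₂ := proj_theta_eq HU H₂ H₁ hπι₂ hπ₂ι₁ hsum' hι₂F hι₁F hΘU hΘ₂ hΘ₁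
  -- the commuting family and the orthogonal-sum form
  set aF : (H₁.endAlg ⊕ H₂.endAlg) ⊕ (Unit ⊕ Unit) → Module.End ℚ U :=
    Sum.elim (Sum.elim (fun a : H₁.endAlg => ι₁ ∘ₗ (a : Module.End ℚ V₁) ∘ₗ π₁)
        (fun a : H₂.endAlg => ι₂ ∘ₗ (a : Module.End ℚ V₂) ∘ₗ π₂))
      (Sum.elim (fun _ : Unit => ι₁ ∘ₗ π₁) (fun _ : Unit => ι₂ ∘ₗ π₂)) with haF
  set φ : LinearMap.BilinForm ℚ U := ψ₁.form.compl₁₂ π₁ π₁ + ψ₂.form.compl₁₂ π₂ π₂ with hφ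
  have hφC : ∀ x y, φ.baseChange ℂ x y = ψ₁.form.baseChange ℂ (π₁.baseChange ℂ x) (π₁.baseChange ℂ y) +
      ψ₂.form.baseChange ℂ (π₂.baseChange ℂ x) (π₂.baseChange ℂ y) := fun x y => by
    rw [hφ, baseChange_add_apply_glued, baseChange_compl₁₂_apply, baseChange_compl₁₂_apply]
  have hφapply : ∀ x y, φ x y = ψ₁.form (π₁ x) (π₁ y) + ψ₂.form (π₂ x) (π₂ y) := fun x y => by
    rw [hφ, LinearMap.add_apply, LinearMap.add_apply, LinearMap.compl₁₂_apply, LinearMap.compl₁₂_apply]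
  set 𝔞 : Submodule ℚ (Module.End ℚ U) := annLie φ eQ aF q with h𝔞
  -- `Θ_U ∈ 𝔞_ℂ`
  have hΘ𝔞 : ΘU ∈ spanC 𝔞 := by
    refine mem_spanC_annLie φ eQ aF q hΘq (fun i => ?_) (fun x y => ?_)
    · apply LinearMap.ext
      intro y
      rcases i with (a | a) | (_ | _)
      · change ΘU ((ι₁ ∘ₗ (a : Module.End ℚ V₁) ∘ₗ π₁).baseChange ℂ y) =
          (ι₁ ∘ₗ (a : Module.End ℚ V₁) ∘ₗ π₁).baseChange ℂ (ΘU y)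
        simp only [LinearMap.baseChange_comp, LinearMap.comp_apply]
        rw [hΘι₁, ← Module.End.mul_apply (f := Θ₁), commute_baseChange_of_mem_hodgeLieC H₁ hΘ₁C a,
          Module.End.mul_apply, hΘπ₁]
      · change ΘU ((ι₂ ∘ₗ (a : Module.End ℚ V₂) ∘ₗ π₂).baseChange ℂ y) =
          (ι₂ ∘ₗ (a : Module.End ℚ V₂) ∘ₗ π₂).baseChange ℂ (ΘU y)
        simp only [LinearMap.baseChange_comp, LinearMap.comp_apply]
        rw [hΘι₂, ← Module.End.mul_apply (f := Θ₂), commute_baseChange_of_mem_hodgeLieC H₂ hΘ₂C a,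
          Module.End.mul_apply, hΘπ₂]
      · change ΘU ((ι₁ ∘ₗ π₁).baseChange ℂ y) = (ι₁ ∘ₗ π₁).baseChange ℂ (ΘU y)
        simp only [LinearMap.baseChange_comp, LinearMap.comp_apply]
        rw [hΘι₁, hΘπ₁]
      · change ΘU ((ι₂ ∘ₗ π₂).baseChange ℂ y) = (ι₂ ∘ₗ π₂).baseChange ℂ (ΘU y)
        simp only [LinearMap.baseChange_comp, LinearMap.comp_apply]
        rw [hΘι₂, hΘπ₂]
    · rw [hφC, hφC, hΘπ₁, hΘπ₁, hΘπ₂, hΘπ₂, formBaseChange_skew_of_mem_hodgeLieC ψ₁ hΘ₁C,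
        formBaseChange_skew_of_mem_hodgeLieC ψ₂ hΘ₂C]
      ring
  -- what membership in `𝔞` gives
  have hbr𝔞 : ∀ X ∈ 𝔞, ∀ X' ∈ 𝔞, X * X' - X' * X ∈ 𝔞 := fun X hX X' hX' =>
    commutator_mem_annLie φ eQ aF q hX hX'
  have hmem : ∀ X ∈ 𝔞, (∀ i, X * aF i = aF i * X) ∧ ∀ v w, φ (X v) w + φ v (X w) = 0 :=
    fun X hX => ((mem_annLie_iff φ eQ aF q X).1 hX).2
  have hP₁ : ∀ X ∈ 𝔞, X * (ι₁ ∘ₗ π₁) = (ι₁ ∘ₗ π₁) * X := fun X hX => (hmem X hX).1 (Sum.inr (Sum.inl ()))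
  have hP₂ : ∀ X ∈ 𝔞, X * (ι₂ ∘ₗ π₂) = (ι₂ ∘ₗ π₂) * X := fun X hX => (hmem X hX).1 (Sum.inr (Sum.inr ()))
  have hTa : ∀ X ∈ 𝔞, ∀ a : H₂.endAlg, X * (ι₂ ∘ₗ (a : Module.End ℚ V₂) ∘ₗ π₂) =
      (ι₂ ∘ₗ (a : Module.End ℚ V₂) ∘ₗ π₂) * X := fun X hX a => (hmem X hX).1 (Sum.inl (Sum.inr a))
  have hc₂comm : ∀ X ∈ 𝔞, ∀ a : H₂.endAlg, (π₂ ∘ₗ X ∘ₗ ι₂) * (a : Module.End ℚ V₂) =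
      (a : Module.End ℚ V₂) * (π₂ ∘ₗ X ∘ₗ ι₂) := by
    intro X hX a
    apply LinearMap.ext
    intro v
    have h := congrArg (fun f : Module.End ℚ U => π₂ (f (ι₂ v))) (hTa X hX a)
    simp only [Module.End.mul_apply, LinearMap.comp_apply, e22] at h
    simp only [Module.End.mul_apply, LinearMap.comp_apply]
    exact h
  have hc₁skew : ∀ X ∈ 𝔞, ∀ v w, ψ₁.form ((π₁ ∘ₗ X ∘ₗ ι₁) v) w + ψ₁.form v ((π₁ ∘ₗ X ∘ₗ ι₁) w) = 0 := by
    intro X hX v w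
    have h := (hmem X hX).2 (ι₁ v) (ι₁ w)
    rw [apply_incl_eq_of_commute_projector hπι₁ (hP₁ X hX) v,
      apply_incl_eq_of_commute_projector hπι₁ (hP₁ X hX) w, hφapply, hφapply] at h
    simp only [e11, e21, map_zero, add_zero] at h
    simpa only [LinearMap.comp_apply] using h
  have hc₂skew : ∀ X ∈ 𝔞, ∀ v w, ψ₂.form ((π₂ ∘ₗ X ∘ₗ ι₂) v) w + ψ₂.form v ((π₂ ∘ₗ X ∘ₗ ι₂) w) = 0 := by
    intro X hX v w
    have h := (hmem X hX).2 (ι₂ v) (ι₂ w)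
    rw [apply_incl_eq_of_commute_projector hπι₂ (hP₂ X hX) v,
      apply_incl_eq_of_commute_projector hπι₂ (hP₂ X hX) w, hφapply, hφapply] at h
    simp only [e22, e12, map_zero, zero_add] at h
    simpa only [LinearMap.comp_apply] using h
  -- (HOM) in the `Θ`-form and the Goursat step
  have hHom' : ∀ f : V₂ →ₗ[ℚ] V₁, Θ₁ ∘ₗ f.baseChange ℂ = f.baseChange ℂ ∘ₗ Θ₂ → f = 0 := fun f hf =>
    eq_zero_of_theta_comp_eq_of_hom_eq_zero hn H₁ H₂ heff₁ heff₂ hΘ₁ hΘ₂ hHom hf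
  have h1 := goursat_incl_corner_mem_of_hom_eq_zero_of_glued hn H₁ H₂ heff₁ heff₂ hπι₁ hπι₂ hπ₁ι₂ hπ₂ι₁ hsum 𝔞
    hbr𝔞 hP₁ hP₂ ψ₁ ψ₂ hc₁skew hc₂skew hc₂comm hΘ₁ hΘ₂ hint b₂ hb0 hb1 cls hcls hTE hglued hqs hΘ𝔞 hΘι₁ hΘι₂ hHom'
  exact ⟨h1, hΘ𝔞⟩

/-- **`Θ_{X₁} ⊕ 0 ∈ 𝔞(q)_ℂ`**: with the hypotheses of the core theorem, the partial Hodge operator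
`ι₁ ∘ Θ₁ ∘ π₁ = (ι₁π₁) Θ_U (ι₁π₁)` of the first factor lies in `𝔞(q)_ℂ` (the compression `X ↦ ι₁π₁ X ι₁π₁`
maps `𝔞` into itself by the core theorem, hence `𝔞_ℂ` into itself). [cite: MoonenZarhin1999LowDim, §3 (3.1) and Lemma (3.4)]
[cite: Deligne1982HodgeCycles, I §3 (proof of Prop. 3.4)] -/
theorem incl₁_theta_proj_mem_spanC_annLie_of_times_gluedBlocks (hn : n = 1) (HU : HodgeStructure U n)
    (H₁ : HodgeStructure V₁ n) (H₂ : HodgeStructure V₂ n) (heff₁ : H₁.IsEffective) (heff₂ : H₂.IsEffective)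
    {ι₁ : V₁ →ₗ[ℚ] U} {π₁ : U →ₗ[ℚ] V₁} {ι₂ : V₂ →ₗ[ℚ] U} {π₂ : U →ₗ[ℚ] V₂}
    (hπι₁ : π₁ ∘ₗ ι₁ = LinearMap.id) (hπι₂ : π₂ ∘ₗ ι₂ = LinearMap.id) (hπ₁ι₂ : π₁ ∘ₗ ι₂ = 0)
    (hπ₂ι₁ : π₂ ∘ₗ ι₁ = 0) (hsum : ι₁ ∘ₗ π₁ + ι₂ ∘ₗ π₂ = LinearMap.id)
    (hι₁F : ∀ p, ∀ x ∈ H₁.piece p (n - p), ι₁.baseChange ℂ x ∈ HU.piece p (n - p))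
    (hι₂F : ∀ p, ∀ x ∈ H₂.piece p (n - p), ι₂.baseChange ℂ x ∈ HU.piece p (n - p))
    (ψ₁ : H₁.Polarization) (ψ₂ : H₂.Polarization)
    {Θ₁ : Module.End ℂ (ℂ ⊗[ℚ] V₁)} (hΘ₁ : ∀ p, ∀ x ∈ H₁.piece p (n - p), Θ₁ x = ((2 * p - n : ℤ) : ℂ) • x)
    {Θ₂ : Module.End ℂ (ℂ ⊗[ℚ] V₂)} (hΘ₂ : ∀ p, ∀ x ∈ H₂.piece p (n - p), Θ₂ x = ((2 * p - n : ℤ) : ℂ) • x)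
    {κ : Type*} [Fintype κ] [DecidableEq κ] [Nonempty κ] {T : κ → Submodule ℂ (ℂ ⊗[ℚ] V₂)}
    (hint : DirectSum.IsInternal T) (b₂ : ∀ k, Module.Basis (Fin 2) ℂ (T k))
    (hb0 : ∀ k, (b₂ k 0 : ℂ ⊗[ℚ] V₂) ∈ H₂.piece 1 (n - 1)) (hb1 : ∀ k, (b₂ k 1 : ℂ ⊗[ℚ] V₂) ∈ H₂.piece 0 (n - 0))
    (cls : κ → κ) (hcls : ∀ k, cls (cls k) = cls k)
    (hTE : ∀ X : Module.End ℚ V₂, (∀ a : H₂.endAlg, X * (a : Module.End ℚ V₂) = (a : Module.End ℚ V₂) * X) →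
      ∀ k, Set.MapsTo (X.baseChange ℂ) (T k) (T k))
    (hglued : ∀ 𝔤₂ : Submodule ℚ (Module.End ℚ V₂), (∀ X ∈ 𝔤₂, ∀ X' ∈ 𝔤₂, X * X' - X' * X ∈ 𝔤₂) →
      Θ₂ ∈ spanC 𝔤₂ → (∀ X ∈ 𝔤₂, ∀ a : H₂.endAlg, X * (a : Module.End ℚ V₂) = (a : Module.End ℚ V₂) * X) →
      (∀ X ∈ 𝔤₂, ∀ v w, ψ₂.form (X v) w + ψ₂.form v (X w) = 0) →
      (∀ Y ∈ spanC 𝔤₂, ∀ k, (blockMat hint b₂ Y k).trace = 0) ∧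
      (∀ Y ∈ spanC 𝔤₂, ∀ k k', cls k = cls k' → blockMat hint b₂ Y k = blockMat hint b₂ Y k') ∧
      (∀ (k₀ : κ) (N : Matrix (Fin 2) (Fin 2) ℂ), N.trace = 0 →
        assemble hint b₂ (fun k => if cls k = cls k₀ then N else 0) ∈ spanC 𝔤₂))
    (hqs : ∀ X : Module.End ℚ V₂, (∀ a : H₂.endAlg, X * (a : Module.End ℚ V₂) = (a : Module.End ℚ V₂) * X) →
      (∀ v w, ψ₂.form (X v) w + ψ₂.form v (X w) = 0) → X ≠ 0 → ∀ k, ∃ x ∈ T k, X.baseChange ℂ x ≠ 0)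
    (hHom : ∀ f : V₂ →ₗ[ℚ] V₁,
      (∀ p, ∀ x ∈ H₂.piece p (n - p), f.baseChange ℂ x ∈ H₁.piece p (n - p)) → f = 0)
    (eQ : Module.Basis (Fin M) ℚ U) (q : (Fin d → Fin m × Fin M) → ℚ)
    {ΘU : Module.End ℂ (ℂ ⊗[ℚ] U)} (hΘU : ∀ p, ∀ x ∈ HU.piece p (n - p), ΘU x = ((2 * p - n : ℤ) : ℂ) • x)
    (hΘq : ∀ u : Fin d → Fin m, wordDerAt ℂ (fun _ : Fin d =>
      LinearMap.toMatrix (Algebra.TensorProduct.basis ℂ eQ) (Algebra.TensorProduct.basis ℂ eQ) ΘU)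
      (wordSlice (fun w => algebraMap ℚ ℂ (q w)) u) = 0) :
    ι₁.baseChange ℂ ∘ₗ Θ₁ ∘ₗ π₁.baseChange ℂ ∈ spanC (annLie (ψ₁.form.compl₁₂ π₁ π₁ + ψ₂.form.compl₁₂ π₂ π₂) eQ
        (Sum.elim (Sum.elim (fun a : H₁.endAlg => ι₁ ∘ₗ (a : Module.End ℚ V₁) ∘ₗ π₁)
            (fun a : H₂.endAlg => ι₂ ∘ₗ (a : Module.End ℚ V₂) ∘ₗ π₂))
          (Sum.elim (fun _ : Unit => ι₁ ∘ₗ π₁) (fun _ : Unit => ι₂ ∘ₗ π₂))) q) := by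
  obtain ⟨h1, hΘ𝔞⟩ := incl_corner_mem_annLie_of_times_gluedBlocks hn HU H₁ H₂ heff₁ heff₂ hπι₁ hπι₂ hπ₁ι₂ hπ₂ι₁ hsum
    hι₁F hι₂F ψ₁ ψ₂ hΘ₁ hΘ₂ hint b₂ hb0 hb1 cls hcls hTE hglued hqs hHom eQ q hΘU hΘq
  set 𝔞 := annLie (ψ₁.form.compl₁₂ π₁ π₁ + ψ₂.form.compl₁₂ π₂ π₂) eQ
        (Sum.elim (Sum.elim (fun a : H₁.endAlg => ι₁ ∘ₗ (a : Module.End ℚ V₁) ∘ₗ π₁)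
            (fun a : H₂.endAlg => ι₂ ∘ₗ (a : Module.End ℚ V₂) ∘ₗ π₂))
          (Sum.elim (fun _ : Unit => ι₁ ∘ₗ π₁) (fun _ : Unit => ι₂ ∘ₗ π₂))) q with h𝔞def
  -- the compression `X ↦ ι₁π₁ X ι₁π₁`, rational and complex
  obtain ⟨L, hL⟩ : ∃ L : Module.End ℚ U →ₗ[ℚ] Module.End ℚ U, ∀ X, L X = ι₁ ∘ₗ (π₁ ∘ₗ X ∘ₗ ι₁) ∘ₗ π₁ :=
    ⟨{ toFun := fun X => ι₁ ∘ₗ (π₁ ∘ₗ X ∘ₗ ι₁) ∘ₗ π₁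
       map_add' := fun X X' => by simp only [LinearMap.add_comp, LinearMap.comp_add]
       map_smul' := fun c X => by simp only [LinearMap.smul_comp, LinearMap.comp_smul, RingHom.id_apply] },
      fun X => rfl⟩
  obtain ⟨LC, hLC⟩ : ∃ L : Module.End ℂ (ℂ ⊗[ℚ] U) →ₗ[ℂ] Module.End ℂ (ℂ ⊗[ℚ] U),
      ∀ Y, L Y = ι₁.baseChange ℂ ∘ₗ (π₁.baseChange ℂ ∘ₗ Y ∘ₗ ι₁.baseChange ℂ) ∘ₗ π₁.baseChange ℂ :=
    ⟨{ toFun := fun Y => ι₁.baseChange ℂ ∘ₗ (π₁.baseChange ℂ ∘ₗ Y ∘ₗ ι₁.baseChange ℂ) ∘ₗ π₁.baseChange ℂ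
       map_add' := fun Y Y' => by simp only [LinearMap.add_comp, LinearMap.comp_add]
       map_smul' := fun c Y => by simp only [LinearMap.smul_comp, LinearMap.comp_smul, RingHom.id_apply] },
      fun Y => rfl⟩
  have hLCc : ∀ X : Module.End ℚ U, LC (X.baseChange ℂ) = (L X).baseChange ℂ := fun X => by
    rw [hLC, hL]
    simp only [LinearMap.baseChange_comp]
  have hmap : 𝔞.map L ≤ 𝔞 := by
    rintro _ ⟨X, hX, rfl⟩
    rw [hL]
    exact h1 X hX
  have hΘι₁ := theta_incl_eq HU H₁ hι₁F hΘU hΘ₁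
  have hLCΘ : LC ΘU = ι₁.baseChange ℂ ∘ₗ Θ₁ ∘ₗ π₁.baseChange ℂ := by
    rw [hLC]
    apply LinearMap.ext
    intro y
    simp only [LinearMap.comp_apply, hΘι₁, proj_incl_baseChange hπι₁]
  rw [← hLCΘ]
  exact spanC_mono hmap (map_mem_spanC_map L LC hLCc 𝔞 hΘ𝔞)

/-- **Theorem (first factor, word model; Moonen–Zarhin Lemma (3.4) with a second factor whose admissible algebras
are glued `𝔰𝔩₂`-blocks).** Let `U = ι₁V₁ ⊕ ι₂V₂` be a presentation compatible with effective weight-one Hodge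
structures `H_U`, `H₁`, `H₂`, polarizations `ψ₁`, `ψ₂`, Hodge operators `Θ₁`, `Θ₂`; let `V₂ ⊗ ℂ = ⊕_k T_k` carry
two-dimensional blocks with `H₂`-adapted bases `b₂ k` and an idempotent class map `cls` with (GLUED) «every
admissible `𝔤₂` has `(𝔤₂)_ℂ = ⊕_{classes} 𝔰𝔩₂` glued» (the tree's `exists_glued_adapted_blockBasis_of_isMurtyTypeWith_one`,
`exists_glued_adapted_blockBasis_of_realSplitting`), (BLOCKS), (QS) «a non-zero rational skew operator commuting
with `End_Hdg(V₂)` is non-zero on every block» — Moonen–Zarhin's «`hg(X₂)` is `ℚ`-simple … and `V_{X₂}` is the only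
irreducible `hg(X₂)`-module which is a length 1 representation of non-compact type» — and `Hom_Hdg(V₂, V₁) = 0`
(«`Hom(X₂, X₁) = 0`»). If a RATIONAL coefficient tensor `q` on `U` is killed, slice by slice, by the matrix of
`Θ_U`, then it is killed by the matrix of `ι₁ ∘ Θ₁ ∘ π₁` — the conclusion of the tree's
`wordDerAt_incl_proj_theta_eq_zero_of_times_nonCMCurve` / `…_of_times_lowRankGeneric`, so the typed-Künneth
pipeline of programmes R22/R23 applies verbatim. No hypothesis on `X₁` (reductivity via `exists_ideal_compl`).
[cite: MoonenZarhin1999LowDim, §3 (3.1), Lemma (3.3), Lemma (3.4), §5 (5.4)] [cite: Deligne1982HodgeCycles, I §3 Prop. 3.4 and Prop. 3.6]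
[cite: Hazama1989, Thm. (= Gordon 7.6.2)] [cite: Hazama1983, §3 (pp. 305–306)] -/
theorem wordDerAt_incl_proj_theta_eq_zero_of_times_gluedBlocks (hn : n = 1) (HU : HodgeStructure U n)
    (H₁ : HodgeStructure V₁ n) (H₂ : HodgeStructure V₂ n) (heff₁ : H₁.IsEffective) (heff₂ : H₂.IsEffective)
    {ι₁ : V₁ →ₗ[ℚ] U} {π₁ : U →ₗ[ℚ] V₁} {ι₂ : V₂ →ₗ[ℚ] U} {π₂ : U →ₗ[ℚ] V₂}
    (hπι₁ : π₁ ∘ₗ ι₁ = LinearMap.id) (hπι₂ : π₂ ∘ₗ ι₂ = LinearMap.id) (hπ₁ι₂ : π₁ ∘ₗ ι₂ = 0)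
    (hπ₂ι₁ : π₂ ∘ₗ ι₁ = 0) (hsum : ι₁ ∘ₗ π₁ + ι₂ ∘ₗ π₂ = LinearMap.id)
    (hι₁F : ∀ p, ∀ x ∈ H₁.piece p (n - p), ι₁.baseChange ℂ x ∈ HU.piece p (n - p))
    (hι₂F : ∀ p, ∀ x ∈ H₂.piece p (n - p), ι₂.baseChange ℂ x ∈ HU.piece p (n - p))
    (ψ₁ : H₁.Polarization) (ψ₂ : H₂.Polarization)
    {Θ₁ : Module.End ℂ (ℂ ⊗[ℚ] V₁)} (hΘ₁ : ∀ p, ∀ x ∈ H₁.piece p (n - p), Θ₁ x = ((2 * p - n : ℤ) : ℂ) • x)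
    {Θ₂ : Module.End ℂ (ℂ ⊗[ℚ] V₂)} (hΘ₂ : ∀ p, ∀ x ∈ H₂.piece p (n - p), Θ₂ x = ((2 * p - n : ℤ) : ℂ) • x)
    {κ : Type*} [Fintype κ] [DecidableEq κ] [Nonempty κ] {T : κ → Submodule ℂ (ℂ ⊗[ℚ] V₂)}
    (hint : DirectSum.IsInternal T) (b₂ : ∀ k, Module.Basis (Fin 2) ℂ (T k))
    (hb0 : ∀ k, (b₂ k 0 : ℂ ⊗[ℚ] V₂) ∈ H₂.piece 1 (n - 1)) (hb1 : ∀ k, (b₂ k 1 : ℂ ⊗[ℚ] V₂) ∈ H₂.piece 0 (n - 0))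
    (cls : κ → κ) (hcls : ∀ k, cls (cls k) = cls k)
    (hTE : ∀ X : Module.End ℚ V₂, (∀ a : H₂.endAlg, X * (a : Module.End ℚ V₂) = (a : Module.End ℚ V₂) * X) →
      ∀ k, Set.MapsTo (X.baseChange ℂ) (T k) (T k))
    (hglued : ∀ 𝔤₂ : Submodule ℚ (Module.End ℚ V₂), (∀ X ∈ 𝔤₂, ∀ X' ∈ 𝔤₂, X * X' - X' * X ∈ 𝔤₂) →
      Θ₂ ∈ spanC 𝔤₂ → (∀ X ∈ 𝔤₂, ∀ a : H₂.endAlg, X * (a : Module.End ℚ V₂) = (a : Module.End ℚ V₂) * X) →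
      (∀ X ∈ 𝔤₂, ∀ v w, ψ₂.form (X v) w + ψ₂.form v (X w) = 0) →
      (∀ Y ∈ spanC 𝔤₂, ∀ k, (blockMat hint b₂ Y k).trace = 0) ∧
      (∀ Y ∈ spanC 𝔤₂, ∀ k k', cls k = cls k' → blockMat hint b₂ Y k = blockMat hint b₂ Y k') ∧
      (∀ (k₀ : κ) (N : Matrix (Fin 2) (Fin 2) ℂ), N.trace = 0 →
        assemble hint b₂ (fun k => if cls k = cls k₀ then N else 0) ∈ spanC 𝔤₂))
    (hqs : ∀ X : Module.End ℚ V₂, (∀ a : H₂.endAlg, X * (a : Module.End ℚ V₂) = (a : Module.End ℚ V₂) * X) →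
      (∀ v w, ψ₂.form (X v) w + ψ₂.form v (X w) = 0) → X ≠ 0 → ∀ k, ∃ x ∈ T k, X.baseChange ℂ x ≠ 0)
    (hHom : ∀ f : V₂ →ₗ[ℚ] V₁,
      (∀ p, ∀ x ∈ H₂.piece p (n - p), f.baseChange ℂ x ∈ H₁.piece p (n - p)) → f = 0)
    (eQ : Module.Basis (Fin M) ℚ U) (q : (Fin d → Fin m × Fin M) → ℚ)
    {ΘU : Module.End ℂ (ℂ ⊗[ℚ] U)} (hΘU : ∀ p, ∀ x ∈ HU.piece p (n - p), ΘU x = ((2 * p - n : ℤ) : ℂ) • x)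
    (hΘq : ∀ u : Fin d → Fin m, wordDerAt ℂ (fun _ : Fin d =>
      LinearMap.toMatrix (Algebra.TensorProduct.basis ℂ eQ) (Algebra.TensorProduct.basis ℂ eQ) ΘU)
      (wordSlice (fun w => algebraMap ℚ ℂ (q w)) u) = 0)
    (u : Fin d → Fin m) :
    wordDerAt ℂ (fun _ : Fin d =>
      LinearMap.toMatrix (Algebra.TensorProduct.basis ℂ eQ) (Algebra.TensorProduct.basis ℂ eQ)
        (ι₁.baseChange ℂ ∘ₗ Θ₁ ∘ₗ π₁.baseChange ℂ))
      (wordSlice (fun w => algebraMap ℚ ℂ (q w)) u) = 0 :=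
  wordDerAt_eq_zero_of_mem_spanC_annLie _ eQ _ q
    (incl₁_theta_proj_mem_spanC_annLie_of_times_gluedBlocks hn HU H₁ H₂ heff₁ heff₂ hπι₁ hπι₂ hπ₁ι₂ hπ₂ι₁ hsum hι₁F
      hι₂F ψ₁ ψ₂ hΘ₁ hΘ₂ hint b₂ hb0 hb1 cls hcls hTE hglued hqs hHom eQ q hΘU hΘq) u

end Main

end HodgeStructure

end Literature.AlgebraicGeometry.Motives

end
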